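/-
Copyright: statement-level skeleton of a published paper (lit-balaban cell, Phase-2 proof seat p33 gen 62). No proof claims
beyond what the kernel checks below.
-/
import Literature.MathematicalPhysics.QuantumFieldTheory.Balaban1983to89.B3Eq322ZeroLattice
import Literature.MathematicalPhysics.QuantumFieldTheory.Balaban1983to89.B3ZdLatticeProfileSums

/-!
# B3 — T. Bałaban, *(Higgs)₂,₃ quantum fields in a finite volume. III. Renormalization*, CMP **88** (1983) 411–445
[Balaban1983Higgs3], pp. 438–439 [PDF 28–29]: the ESTIMATE sentences around **(3.21)–(3.23)** — *"ηG_k(x,x) is convergent to some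
finite constant as η → 0"*, *"the expression in the square bracket in (3.23) containing the second term will be convergent"*, *"Hence
the last graph in (3.22) defines a vertex with some convergent function"* — **IN `d = 2` ON THE PRINT'S CARRIER OF RECORD, the
zero-field infinite-lattice propagator `G_k(0) = G_k(ηℤ², 0)`** (the `d + 1 = 2` instance of p26's `ηℤ^{d+1}` pieces `gpieceZ` /
resummations `GresumZ` and of p40 F1's (3.21)/(3.22)/(3.23) objects `expr321aZ` / `expr321bZ` / `rem322Z` / `bracket323Z` / `expr323Z`,
all of which are `d`-generic): the `ℤ²` twins of p39 g17's `B3GkTadpoleLimitZeroLattice` (tadpole, `ηℤ³`), p40 g71's F2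
`B3Eq323ZeroLattice` / F3 `B3Eq322VertexZeroLattice` (bracket and vertex bounds, `ξℤ³`/`ηℤ³`), and the lattice counterparts of p27 g30's
torus members `B3TadpoleZeroTorusTwoDim` / `B3Eq322ZeroTorusTwoDim`.

statement-level skeleton of published theorems with citation tags; proofs where landed; nothing here is a claim about
the Yang–Mills mass gap

PDF held: `paper:balaban1983-higgs-2-3-quantum-fields-finite-volume` (journal page = PDF page + 410); pp. 438–439 [PDF 28–29] read in
the OCR text (`p0028.txt`, `p0029.txt` of `lit read`), p. 429 [PDF 19] (*"in d = 2 graphs are more convergent"*), p. 426 [PDF 16]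
((2.10)).

CITATION HEADER (lean-in-tree rule).  Part of the lit-balaban TYPED SKELETON (HOME `run/shared/lean/pub/lit-balaban/`), Phase 2,
proof seat p33 generation 62 (free-target protocol G.5-34(d)).  Row **B3.Eq3.21-3.24** of `HOME/lit-balaban-r15/ROWS-B3.md` (fold
owner r15, referee ref-4): the *"d = 2 lattice laws for the pp. 438–439 ESTIMATE sentences on the carrier ηℤ²"* item (lead g10's
Q10 word, HOME/STATUS 2026-08-23T03:30:01Z; OFFERED to this seat by the owner r15 g14, seat INBOX 03:38:11Z; under the lead's
REVISED Q10 word 03:41:38Z — *"d = 2 is print's blanket remark p. 429, i.e. SCOPE … the M item for the ηℤ² laws stays a welcome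
member target with zero head weight"* — this file is a MEMBER of the row, not a head condition).  CONSUMED BY NAME, nothing
re-proved or restated: p26 g34's `B3Ineq314ZeroLattice` (`etaZ`, `scaleZ`, `gpieceZ`, `GresumZ`, `sum_gpieceZ_range`, the (2.10)
value clause `abs_gpieceZ_le`) and `B3Ineq211ZeroLattice.ineq210_zeroLatticeH` (the (2.10) pair `δ₁, C` of the lattice pieces,
uniform in `k` and the window), p40 g71's `B3Eq322ZeroLattice` (`d1KernelZ`, `ker321Z`, `bracket323Z`, `expr323Z`, `expr321aZ`,
`expr321bZ`, `rem322Z`, `bracket323Z_split`, `bracket323Z_sum_sum`, `abs_d1KernelZ_gpieceZ_le` = the (2.10) derivative clause,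
`abs_expr321aZ_le`, `sum_expr321bZ_eq_zeroLattice`), p26's `B3Taylor310Lattice` (`dist₁`, `pd`), p39 g13's one-dimensional sum
`B3ZdLatticeProfileSums.sum_Ico_pow_mul_exp_le` (`Σ_{1≤n<b} n^m e^{−xn} ≤ 32/x^{m+1}`).

THE PRINTED TEXT (pp. 438–439, verbatim).  *"Here a propagator without arrows denotes an arbitrary propagator, either G_k(A), or
G_k(0). There are only two such graphs [(3.21)]. The first graph defines a local vertex with the function ηG_k(x,x) and because ηG_k(x,x)
is convergent to some finite constant as η → 0, it has the necessary form. … we sum over proper orderings and j-indices and we get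
Σ_{μ=1}^d Σ_x η^dφ(x)·[q²Σ_{x′}η^d(∂^η_μG^η_{j″}(0))(x,x′)g(x)G^η_{j″}(x,x′)g′(x′)](∂^η_μφ′)(x). (3.23) Further if we take g′(x′) = g′(x)
+ ((g′(x′) − g′(x))/|x′ − x|)|x′ − x|, then the expression in the square bracket in (3.23) containing the second term will be
convergent and the expression with the first term is equal to q²g(x)g′(x)Σ_{x′}η^d(∂^η_μG^η_{j″}(0))(x,x′)G^η_{j″}(x,x′). … Hence the
last graph in (3.22) defines a vertex with some convergent function."*  The paper is written for `d = 2, 3` (title; (2.1) p. 422;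
(3.24) keeps the factor `ξ^{3−d}`); p. 429: *"in d = 2 graphs are more convergent"*.

THE `d = 2` MECHANISM (why absolute values suffice).  At `d + 1 = 2` the (2.10) laws of the pieces read `|G^η_{(j)}(0)(x,x′)| ≤
Ce^{−δ′η|x−x′|₁/L^jη}` (NO inverse power) and `|(∂^η_μG^η_{(j)}(0))(x,x′)| ≤ C(L^jη)^{−1}e^{−δ′η|x−x′|₁/L^jη}` (`δ′ = δ₁/2`;
`abs_gpieceZ_le_two`, `abs_d1KernelZ_gpieceZ_le_two`).  For a pair of pieces `(j, j′)` the `ℤ²` sum factorizes over the two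
coordinates and the one-dimensional sums are p39's: `Σ_{x′∈Λ′}η²e^{−tη|x−x′|₁} ≤ (η + 64/t)²` with `t = δ′((L^jη)^{−1} + (L^{j′}η)^{−1}) ≥
δ′/min(L^jη, L^{j′}η)` and `η ≤ min`, so the pair bracket is `≤ C²(1 + 64/δ′)²·min(L^jη,L^{j′}η)²/(L^jη) ≤ K₁·min(L^jη, L^{j′}η)`
(`abs_bracket323Z_pair_le_two`), and `Σ_{j,j′<n}min(L^jη,L^{j′}η) ≤ (Σ_{j<n}(√L)^{j−k})² ≤ (√L − 1)^{−2}` (`min ≤` geometric mean):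
the (3.23) bracket on `𝒢_n = Σ_{j<n}G^η_{(j)}(0)` is bounded by a constant `C₁(L, window)` for ALL `|g|, |g′| ≤ 1` — the p. 439
device of splitting `g′` is not needed in `d = 2` (as p27 observed on the torus), but its two members are bounded too: the first term
by `C₁`, the second (under `|g′(x′) − g′(x)| ≤ K′η|x − x′|₁`) by `C₂K′` with the extra weight `η|x − x′|₁` summed by the `m = 1` case
of p39's lemma (`abs_second323Z_pair_le_two`: pair bound `≤ K₂K′·min³/(L^jη) ≤ K₂K′·(L^jη)(L^{j′}η)`, `Σ_{j,j′} ≤ K₂K′ℓ^{−2}`).  The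
tadpole: `|ηG^η_{(j)}(0)(x,x)| ≤ Cη` for every piece, so `|η𝒢_n(x,x)| ≤ C·nη ≤ C·kL^{−k} → 0` — the p. 438 *"finite constant"* is `0`
in `d = 2` (as on the torus, p27's `B3TadpoleZeroTorusTwoDim`, and against the `d = 3` constant of p39's `B3GkTadpoleLimitZeroLattice`).

WHAT IS PROVED (integer labels `Fin 2 → ℤ` of `ηℤ²`, `η = etaZ ℓ k = L^{−k}`, `L = ℓ + 1 ≥ 2`; window `[a₋,a₊] × [0,m²₊]`, `a₋ > 0`;
constants existential, functions of `L` and the window only — uniform in `k ≥ 1`, the resummation index `1 ≤ n ≤ k`, the sites and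
all finite localization sets).
* §1–§3 (private kernels) the one- and two-dimensional lattice sums and the geometric scale sums above.
* §4 MODEL-FREE PAIR BOUNDS on `ℤ²` under `d = 2` kernel laws: **`abs_bracket323Z_pair_le_two`** (the whole bracket, `|g|,|g′| ≤ 1`),
  **`abs_second323Z_pair_le_two`** (the second term of the p. 439 splitting, `g′` Lipschitz).
* §5 THE LAWS AND THE RESUMMED BOUNDS FOR `G_k(ηℤ², 0)`: `abs_gpieceZ_le_two`, `abs_d1KernelZ_gpieceZ_le_two` ((2.10) at `d + 1 = 2`),
  **`exists_bracket323Z_two_bound`** — `∃ C₁ C₂ > 0`: for every `k ≥ 1`, window point, `1 ≤ n ≤ k`, `μ`, `Λ′`, `x`: the first term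
  `|Σ_{x′∈Λ′}η²(∂^η_μ𝒢_n)(x,x′)𝒢_n(x,x′)| ≤ C₁`; for all `|g|,|g′| ≤ 1` the bracket `|[(3.23)](x)| ≤ C₁`; and for `g′` with
  `|g′(x′) − g′(x)| ≤ K′η|x − x′|₁` the second term `≤ C₂K′` (*"the second term will be convergent"*); the generic vertex lemma
  `abs_expr323Z_le_of_bracket` (every `d`); **`exists_expr323Z_two_bound`** — `|expr323Z η q 𝒢_n 𝒢_n g g′ φ φ′ Λ Λ′| ≤
  C₁·Σ_μΣ_{x∈Λ}η²‖φ(x)‖‖q²(∂^η_μφ′)(x)‖` (*"defines a vertex with some convergent function"*, the `ℤ²` twin of F3's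
  `exists_expr323Z_zeroLattice_bound`, with NO Lipschitz or support hypothesis on `g′`); **`sum_expr321bZ_sub_rem322Z_two`** — (3.22)/(3.23)
  end to end on `ηℤ²` (twin of F3's `sum_expr321bZ_sub_rem322Z_zeroLattice`); `exists_second323Z_two_bound_sup` (the second-term
  clause under F3's sup-distance Lipschitz reading, for the record).
* §6 THE TADPOLE SENTENCE IN `d = 2`: **`exists_etaZ_mul_GresumZ_diag_two_bound`** (`|η𝒢_n(x,x)| ≤ C·nη`), `natCast_mul_etaZ_le_one`
  (`kη ≤ 1`), `tendsto_natCast_mul_etaZ` (`kL^{−k} → 0`), **`tendsto_etaZ_mul_GresumZ_diag_two`** (`ηG_k(ηℤ²,0)(x,x) → 0` as `k → ∞`,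
  i.e. `η = L^{−k} → 0`), **`exists_expr321aZ_two_bound`** (the first graph of (3.21) is a local vertex whose function is `≤ C·kη ≤ C`
  and tends to `0`).
HONEST SCOPE / DECLARED DIVERGENCES.  (i) `d + 1 = 2` only, zero external field, both internal lines the scalar pieces `G^η_{(j)}(0)` of
`G_k(0)` (the scope of F1/F2/F3 and of p26's carrier; at zero field the vector-field piece has the same kernel).  (ii) `|x − x′|` is the
`ℓ¹` lattice distance `η·dist₁` (p26's reading; `η|x − x′|_∞ ≤ η|x − x′|₁`, so the sup-distance Lipschitz hypothesis of F2/F3 implies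
ours: `exists_second323Z_two_bound_sup`).  (iii) The bounds are proved on the `η`-lattice directly by absolute values; the p. 439
rescaling to the `ξ = L^{−j″}`-lattice and the (3.16) replacement `G^ξ(0) → C^ξ` (the `d = 3` route of F2, *"the same method as in
(3.16)"*) are not needed in `d = 2` and not re-derived; (3.24) and its `d = 2` limit `0` are p03's `B3Eq324Parseval.eq324_rhs_tendsto_two`
(not restated).  (iv) The resummation index `n ≤ k` is general (`n = k` is `G_k(0)` itself, `B3Ineq314ZeroLattice.GresumZ_top`); the
admissibility bookkeeping of orderings is taken literally over `[0,n)²` as in F1.  (v) Constants existential (closed forms in the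
proofs: `C₁ = C²(1 + 128/δ₁)²(√L − 1)^{−2}`, `C₂ = 128C²((2/δ₁)² + 64(2/δ₁)³)ℓ^{−2}` with p26's (2.10) pair `(δ₁, C)`).  NOT claimed:
anything in `d + 1 = 3` (F2/F3, p39), non-zero backgrounds, the pictures, the torus members (p27).  Theorems only — no definitions, no
Literature fact minted, no `sorry`; Mathlib + the cited tree files; standard axioms.  Value = the `d = 2` members of the pp. 438–439
estimate sentences on the printed carrier, NOT summit progress.  Unit `lit-balaban-p33-g62` (Phase-2 proof seat p33, gen 62); HOME
`run/shared/lean/pub/lit-balaban/` (row B3.Eq3.21-3.24, FILED.md, STATUS.md), 2026-08-23.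
-/

open scoped BigOperators RealInnerProductSpace Topology
open Finset Filter

namespace Literature.MathematicalPhysics.QuantumFieldTheory.Balaban1983to89.B3Eq323ZeroLatticeTwoDim

open B3Taylor310Lattice (dist₁ pd dist₁_self natAbs_sub_le_dist₁)
open B3Ineq313Lattice (KernelZ)
open B3Ineq314ZeroLattice (etaZ scaleZ gpieceZ GresumZ etaZ_pos scaleZ_pos scaleZ_mono sum_gpieceZ_range abs_gpieceZ_le)
open B3Ineq211ZeroLattice (zeroLatticeKernelsH ineq210_zeroLatticeH)
open B3Eq322ZeroLattice (d1KernelZ ker321Z bracket323Z expr323Z expr321aZ expr321bZ rem322Z bracket323Z_split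
  bracket323Z_sum_sum abs_d1KernelZ_gpieceZ_le abs_expr321aZ_le sum_expr321bZ_eq_zeroLattice)
open B3ZdLatticeProfileSums (sum_Ico_pow_mul_exp_le)
open Literature.MathematicalPhysics.QuantumFieldTheory.Balaban1983to89.B4ContourShift (supNorm exists_supNorm_eq)

noncomputable section

/-! ## §1 One-dimensional sums over arbitrary finite sets of integers -/

section OneDim

/-- kernel: over a finite set of integers all `> c`, `Σ|n − c|^m e^{−t|n − c|} ≤ 32/t^{m+1}` (`m ≤ 2`): inject `n ↦ n − c` into
`[1, B)` and use p39's `sum_Ico_pow_mul_exp_le`. [folklore] -/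
private theorem sum_gt_pow_mul_exp_le {t : ℝ} (ht : 0 < t) {m : ℕ} (hm : m ≤ 2) (c : ℤ) (S : Finset ℤ)
    (hS : ∀ n ∈ S, c < n) :
    ∑ n ∈ S, |((n : ℝ) - c)| ^ m * Real.exp (-(t * |((n : ℝ) - c)|)) ≤ 32 / t ^ (m + 1) := by
  classical
  have hcast : ∀ n ∈ S, |((n : ℝ) - c)| = (((n - c).toNat : ℕ) : ℝ) := by
    intro n hn
    have h0 : (0 : ℤ) ≤ n - c := (sub_pos.2 (hS n hn)).le
    have e : (((n - c).toNat : ℕ) : ℤ) = n - c := Int.toNat_of_nonneg h0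
    have e' : (((n - c).toNat : ℕ) : ℝ) = (n : ℝ) - c := by exact_mod_cast e
    have h0' : (0 : ℝ) ≤ (n : ℝ) - c := by exact_mod_cast h0
    rw [e', abs_of_nonneg h0']
  have hinj : Set.InjOn (fun n : ℤ => (n - c).toNat) ↑S := by
    intro n hn n' hn' h
    have e1 : (((n - c).toNat : ℕ) : ℤ) = n - c := Int.toNat_of_nonneg (sub_pos.2 (hS n hn)).le
    have e2 : (((n' - c).toNat : ℕ) : ℤ) = n' - c := Int.toNat_of_nonneg (sub_pos.2 (hS n' hn')).le
    have h' : ((n - c).toNat : ℕ) = (n' - c).toNat := h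
    have : (n : ℤ) - c = n' - c := by rw [← e1, ← e2, h']
    linarith
  have h1 : ∀ n ∈ S, 1 ≤ (n - c).toNat := by
    intro n hn
    have : (0 : ℤ) < (((n - c).toNat : ℕ) : ℤ) := by
      rw [Int.toNat_of_nonneg (sub_pos.2 (hS n hn)).le]; exact sub_pos.2 (hS n hn)
    omega
  have hsub : S.image (fun n : ℤ => (n - c).toNat) ⊆ Finset.Ico 1 (S.sup (fun n : ℤ => (n - c).toNat) + 1) := by
    intro i hi
    rw [Finset.mem_image] at hi
    obtain ⟨n, hn, rfl⟩ := hi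
    rw [Finset.mem_Ico]
    exact ⟨h1 n hn, Nat.lt_succ_of_le (Finset.le_sup (f := fun n : ℤ => (n - c).toNat) hn)⟩
  calc ∑ n ∈ S, |((n : ℝ) - c)| ^ m * Real.exp (-(t * |((n : ℝ) - c)|))
      = ∑ n ∈ S, ((((n - c).toNat : ℕ) : ℝ) ^ m * Real.exp (-(t * (((n - c).toNat : ℕ) : ℝ)))) :=
        Finset.sum_congr rfl fun n hn => by rw [hcast n hn]
    _ = ∑ i ∈ S.image (fun n : ℤ => (n - c).toNat), ((i : ℝ) ^ m * Real.exp (-(t * i))) :=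
        (Finset.sum_image (f := fun i : ℕ => (i : ℝ) ^ m * Real.exp (-(t * i))) hinj).symm
    _ ≤ ∑ i ∈ Finset.Ico 1 (S.sup (fun n : ℤ => (n - c).toNat) + 1), ((i : ℝ) ^ m * Real.exp (-(t * i))) :=
        Finset.sum_le_sum_of_subset_of_nonneg hsub fun i _ _ => by positivity
    _ ≤ 32 / t ^ (m + 1) := sum_Ico_pow_mul_exp_le ht hm _

/-- kernel: over ANY finite set of integers, `Σ|n − c|^m e^{−t|n − c|} ≤ 0^m + 64/t^{m+1}` (`m ≤ 2`; the point `n = c` and the two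
half-lines). [folklore] -/
private theorem sum_pow_mul_exp_abs_le {t : ℝ} (ht : 0 < t) {m : ℕ} (hm : m ≤ 2) (S : Finset ℤ) (c : ℤ) :
    ∑ n ∈ S, |((n : ℝ) - c)| ^ m * Real.exp (-(t * |((n : ℝ) - c)|)) ≤ (0 : ℝ) ^ m + 64 / t ^ (m + 1) := by
  classical
  set F : ℤ → ℝ := fun n => |((n : ℝ) - c)| ^ m * Real.exp (-(t * |((n : ℝ) - c)|)) with hF
  have hF0 : ∀ n, 0 ≤ F n := fun n => by positivity
  -- the half-line `n > c`
  have hplus : ∑ n ∈ S.filter (fun n => c < n), F n ≤ 32 / t ^ (m + 1) :=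
    sum_gt_pow_mul_exp_le ht hm c _ fun n hn => (Finset.mem_filter.1 hn).2
  -- the half-line `n < c`, reflected by `n ↦ 2c − n`
  have hrefl : ∀ n, F (2 * c - n) = F n := by
    intro n
    simp only [hF]
    push_cast
    rw [show (2 : ℝ) * c - n - c = -((n : ℝ) - c) by ring, abs_neg]
  have hinj : Set.InjOn (fun n : ℤ => 2 * c - n) ↑((S.filter (fun n => ¬c < n)).filter (fun n => n < c)) := by
    intro n _ n' _ h
    have h' : 2 * c - n = 2 * c - n' := h
    linarith
  have hminus : ∑ n ∈ (S.filter (fun n => ¬c < n)).filter (fun n => n < c), F n ≤ 32 / t ^ (m + 1) := by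
    calc ∑ n ∈ (S.filter (fun n => ¬c < n)).filter (fun n => n < c), F n
        = ∑ n ∈ (S.filter (fun n => ¬c < n)).filter (fun n => n < c), F (2 * c - n) :=
          Finset.sum_congr rfl fun n _ => (hrefl n).symm
      _ = ∑ n' ∈ ((S.filter (fun n => ¬c < n)).filter (fun n => n < c)).image (fun n : ℤ => 2 * c - n), F n' :=
          (Finset.sum_image hinj).symm
      _ ≤ 32 / t ^ (m + 1) := by
          refine sum_gt_pow_mul_exp_le ht hm c _ fun n' hn' => ?_
          rw [Finset.mem_image] at hn'
          obtain ⟨n, hn, rfl⟩ := hn'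
          have := (Finset.mem_filter.1 hn).2
          linarith
  -- the point `n = c`
  have hzero : ∑ n ∈ (S.filter (fun n => ¬c < n)).filter (fun n => ¬n < c), F n ≤ (0 : ℝ) ^ m := by
    have hsub : (S.filter (fun n => ¬c < n)).filter (fun n => ¬n < c) ⊆ {c} := by
      intro n hn
      rw [Finset.mem_filter, Finset.mem_filter] at hn
      rw [Finset.mem_singleton]
      omega
    calc ∑ n ∈ (S.filter (fun n => ¬c < n)).filter (fun n => ¬n < c), F n ≤ ∑ n ∈ ({c} : Finset ℤ), F n :=
          Finset.sum_le_sum_of_subset_of_nonneg hsub fun n _ _ => hF0 n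
      _ = (0 : ℝ) ^ m := by simp [hF]
  have hsplit : ∑ n ∈ S, F n = ∑ n ∈ S.filter (fun n => c < n), F n +
      (∑ n ∈ (S.filter (fun n => ¬c < n)).filter (fun n => n < c), F n +
        ∑ n ∈ (S.filter (fun n => ¬c < n)).filter (fun n => ¬n < c), F n) := by
    rw [Finset.sum_filter_add_sum_filter_not, Finset.sum_filter_add_sum_filter_not]
  have h64 : (64 : ℝ) / t ^ (m + 1) = 32 / t ^ (m + 1) + 32 / t ^ (m + 1) := by ring
  show ∑ n ∈ S, F n ≤ (0 : ℝ) ^ m + 64 / t ^ (m + 1)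
  rw [hsplit, h64]
  linarith

/-- kernel: `Σ_{n∈S} e^{−t|n − c|} ≤ 1 + 64/t` for every finite `S ⊆ ℤ`. [folklore] -/
private theorem sum_exp_abs_le {t : ℝ} (ht : 0 < t) (S : Finset ℤ) (c : ℤ) :
    ∑ n ∈ S, Real.exp (-(t * |((n : ℝ) - c)|)) ≤ 1 + 64 / t := by
  have h := sum_pow_mul_exp_abs_le ht (Nat.zero_le 2) S c
  simpa using h

/-- kernel: `Σ_{n∈S} |n − c|e^{−t|n − c|} ≤ 64/t²` for every finite `S ⊆ ℤ`. [folklore] -/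
private theorem sum_abs_mul_exp_abs_le {t : ℝ} (ht : 0 < t) (S : Finset ℤ) (c : ℤ) :
    ∑ n ∈ S, |((n : ℝ) - c)| * Real.exp (-(t * |((n : ℝ) - c)|)) ≤ 64 / t ^ 2 := by
  have h := sum_pow_mul_exp_abs_le ht (by norm_num : 1 ≤ 2) S c
  simpa using h

end OneDim

/-! ## §2 Sums over finite subsets of `ℤ²` -/

section TwoDim

/-- kernel: a nonnegative product function summed over a finite subset of `ℤ²` is at most the product of the one-dimensional sums over
the two coordinate projections. [folklore] -/
private theorem sum_mul_le_prod_sum (Λ : Finset (Fin 2 → ℤ)) {f₀ f₁ : ℤ → ℝ} (h₀ : ∀ n, 0 ≤ f₀ n) (h₁ : ∀ n, 0 ≤ f₁ n) :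
    ∑ x ∈ Λ, f₀ (x 0) * f₁ (x 1) ≤
      (∑ a ∈ Λ.image (fun x => x 0), f₀ a) * (∑ b ∈ Λ.image (fun x => x 1), f₁ b) := by
  classical
  set t : Fin 2 → Finset ℤ := fun i => Λ.image (fun x => x i) with ht
  set f : Fin 2 → ℤ → ℝ := fun i => if i = 0 then f₀ else f₁ with hf
  have hf0 : f 0 = f₀ := by simp [hf]
  have hf1 : f 1 = f₁ := by simp [hf]
  have hfnn : ∀ i n, 0 ≤ f i n := by
    intro i n
    by_cases hi : i = 0
    · simp only [hf, if_pos hi]; exact h₀ n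
    · simp only [hf, if_neg hi]; exact h₁ n
  have hsub : Λ ⊆ Fintype.piFinset t :=
    fun x hx => Fintype.mem_piFinset.2 fun i => Finset.mem_image_of_mem (fun x => x i) hx
  calc ∑ x ∈ Λ, f₀ (x 0) * f₁ (x 1) = ∑ x ∈ Λ, ∏ i, f i (x i) := by
        refine Finset.sum_congr rfl fun x _ => ?_
        rw [Fin.prod_univ_two, hf0, hf1]
    _ ≤ ∑ x ∈ Fintype.piFinset t, ∏ i, f i (x i) :=
        Finset.sum_le_sum_of_subset_of_nonneg hsub fun x _ _ => Finset.prod_nonneg fun i _ => hfnn i (x i)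
    _ = ∏ i, ∑ n ∈ t i, f i n := (Finset.prod_univ_sum t f).symm
    _ = (∑ a ∈ Λ.image (fun x => x 0), f₀ a) * (∑ b ∈ Λ.image (fun x => x 1), f₁ b) := by
        rw [Fin.prod_univ_two, hf0, hf1]

/-- kernel: on `ℤ²`, `|x − x′|₁ = |x′₀ − x₀| + |x′₁ − x₁|` (real form). [folklore] -/
private theorem dist₁_two (x x' : Fin 2 → ℤ) :
    (dist₁ (d := 1) x x' : ℝ) = |((x' 0 : ℝ) - x 0)| + |((x' 1 : ℝ) - x 1)| := by
  unfold dist₁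
  rw [Fin.sum_univ_two]
  push_cast
  rw [Nat.cast_natAbs, Nat.cast_natAbs]
  push_cast
  rw [abs_sub_comm ((x 0 : ℤ) : ℝ), abs_sub_comm ((x 1 : ℤ) : ℝ)]

/-- kernel: `Σ_{x′∈Λ′}e^{−τ|x − x′|₁} ≤ (1 + 64/τ)²` on `ℤ²`, every finite `Λ′`. [folklore] -/
private theorem sum_exp_dist₁_le {τ : ℝ} (hτ : 0 < τ) (x : Fin 2 → ℤ) (Λ' : Finset (Fin 2 → ℤ)) :
    ∑ x' ∈ Λ', Real.exp (-(τ * (dist₁ (d := 1) x x' : ℝ))) ≤ (1 + 64 / τ) ^ 2 := by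
  have hE : ∀ x' : Fin 2 → ℤ, Real.exp (-(τ * (dist₁ (d := 1) x x' : ℝ))) =
      Real.exp (-(τ * |((x' 0 : ℝ) - x 0)|)) * Real.exp (-(τ * |((x' 1 : ℝ) - x 1)|)) := by
    intro x'
    rw [dist₁_two, ← Real.exp_add]
    congr 1; ring
  calc ∑ x' ∈ Λ', Real.exp (-(τ * (dist₁ (d := 1) x x' : ℝ)))
      = ∑ x' ∈ Λ', Real.exp (-(τ * |((x' 0 : ℝ) - x 0)|)) * Real.exp (-(τ * |((x' 1 : ℝ) - x 1)|)) :=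
        Finset.sum_congr rfl fun x' _ => hE x'
    _ ≤ (∑ a ∈ Λ'.image (fun x' => x' 0), Real.exp (-(τ * |(((a : ℤ) : ℝ) - x 0)|))) *
          (∑ b ∈ Λ'.image (fun x' => x' 1), Real.exp (-(τ * |(((b : ℤ) : ℝ) - x 1)|))) :=
        sum_mul_le_prod_sum Λ' (f₀ := fun a => Real.exp (-(τ * |(((a : ℤ) : ℝ) - x 0)|)))
          (f₁ := fun b => Real.exp (-(τ * |(((b : ℤ) : ℝ) - x 1)|))) (fun _ => (Real.exp_pos _).le)
          (fun _ => (Real.exp_pos _).le)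
    _ ≤ (1 + 64 / τ) * (1 + 64 / τ) :=
        mul_le_mul (sum_exp_abs_le hτ _ _) (sum_exp_abs_le hτ _ _)
          (Finset.sum_nonneg fun _ _ => (Real.exp_pos _).le) (by positivity)
    _ = (1 + 64 / τ) ^ 2 := (sq _).symm

/-- kernel: `Σ_{x′∈Λ′}|x − x′|₁e^{−τ|x − x′|₁} ≤ 2·(64/τ²)(1 + 64/τ)` on `ℤ²`, every finite `Λ′`. [folklore] -/
private theorem sum_dist₁_mul_exp_le {τ : ℝ} (hτ : 0 < τ) (x : Fin 2 → ℤ) (Λ' : Finset (Fin 2 → ℤ)) :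
    ∑ x' ∈ Λ', (dist₁ (d := 1) x x' : ℝ) * Real.exp (-(τ * (dist₁ (d := 1) x x' : ℝ))) ≤
      2 * ((64 / τ ^ 2) * (1 + 64 / τ)) := by
  have hE : ∀ x' : Fin 2 → ℤ, (dist₁ (d := 1) x x' : ℝ) * Real.exp (-(τ * (dist₁ (d := 1) x x' : ℝ))) =
      (|((x' 0 : ℝ) - x 0)| * Real.exp (-(τ * |((x' 0 : ℝ) - x 0)|))) * Real.exp (-(τ * |((x' 1 : ℝ) - x 1)|)) +
        Real.exp (-(τ * |((x' 0 : ℝ) - x 0)|)) * (|((x' 1 : ℝ) - x 1)| * Real.exp (-(τ * |((x' 1 : ℝ) - x 1)|))) := by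
    intro x'
    rw [dist₁_two]
    have : Real.exp (-(τ * (|((x' 0 : ℝ) - x 0)| + |((x' 1 : ℝ) - x 1)|))) =
        Real.exp (-(τ * |((x' 0 : ℝ) - x 0)|)) * Real.exp (-(τ * |((x' 1 : ℝ) - x 1)|)) := by
      rw [← Real.exp_add]; congr 1; ring
    rw [this]; ring
  rw [Finset.sum_congr rfl fun x' _ => hE x', Finset.sum_add_distrib, two_mul]
  refine add_le_add ?_ ?_
  · calc ∑ x' ∈ Λ', (|((x' 0 : ℝ) - x 0)| * Real.exp (-(τ * |((x' 0 : ℝ) - x 0)|))) *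
            Real.exp (-(τ * |((x' 1 : ℝ) - x 1)|))
        ≤ (∑ a ∈ Λ'.image (fun x' => x' 0), |(((a : ℤ) : ℝ) - x 0)| * Real.exp (-(τ * |(((a : ℤ) : ℝ) - x 0)|))) *
            (∑ b ∈ Λ'.image (fun x' => x' 1), Real.exp (-(τ * |(((b : ℤ) : ℝ) - x 1)|))) :=
          sum_mul_le_prod_sum Λ' (f₀ := fun a => |(((a : ℤ) : ℝ) - x 0)| * Real.exp (-(τ * |(((a : ℤ) : ℝ) - x 0)|)))
            (f₁ := fun b => Real.exp (-(τ * |(((b : ℤ) : ℝ) - x 1)|))) (fun _ => by positivity)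
            (fun _ => (Real.exp_pos _).le)
      _ ≤ (64 / τ ^ 2) * (1 + 64 / τ) :=
          mul_le_mul (sum_abs_mul_exp_abs_le hτ _ _) (sum_exp_abs_le hτ _ _)
            (Finset.sum_nonneg fun _ _ => (Real.exp_pos _).le) (by positivity)
  · calc ∑ x' ∈ Λ', Real.exp (-(τ * |((x' 0 : ℝ) - x 0)|)) *
            (|((x' 1 : ℝ) - x 1)| * Real.exp (-(τ * |((x' 1 : ℝ) - x 1)|)))
        ≤ (∑ a ∈ Λ'.image (fun x' => x' 0), Real.exp (-(τ * |(((a : ℤ) : ℝ) - x 0)|))) *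
            (∑ b ∈ Λ'.image (fun x' => x' 1), |(((b : ℤ) : ℝ) - x 1)| * Real.exp (-(τ * |(((b : ℤ) : ℝ) - x 1)|))) :=
          sum_mul_le_prod_sum Λ' (f₀ := fun a => Real.exp (-(τ * |(((a : ℤ) : ℝ) - x 0)|)))
            (f₁ := fun b => |(((b : ℤ) : ℝ) - x 1)| * Real.exp (-(τ * |(((b : ℤ) : ℝ) - x 1)|))) (fun _ => (Real.exp_pos _).le)
            (fun _ => by positivity)
      _ ≤ (1 + 64 / τ) * (64 / τ ^ 2) :=
          mul_le_mul (sum_exp_abs_le hτ _ _) (sum_abs_mul_exp_abs_le hτ _ _)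
            (Finset.sum_nonneg fun _ _ => by positivity) (by positivity)
      _ = (64 / τ ^ 2) * (1 + 64 / τ) := mul_comm _ _

end TwoDim

/-! ## §3 Geometric scale sums -/

section Scales

variable {ℓ k : ℕ}

/-- kernel: `Σ_{j<n} M^j/M^k ≤ 1/(M − 1)` for `M > 1`, `n ≤ k`. [folklore] -/
private theorem sum_geom_div_le {M : ℝ} (hM : 1 < M) {n k : ℕ} (hnk : n ≤ k) :
    ∑ j ∈ Finset.range n, M ^ j * (M ^ k)⁻¹ ≤ (M - 1)⁻¹ := by
  have hM0 : 0 < M := zero_lt_one.trans hM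
  have hM1 : M ≠ 1 := ne_of_gt hM
  have hMk : 0 < M ^ k := pow_pos hM0 k
  have hsub : 0 < M - 1 := sub_pos.2 hM
  calc ∑ j ∈ Finset.range n, M ^ j * (M ^ k)⁻¹ = (∑ j ∈ Finset.range n, M ^ j) * (M ^ k)⁻¹ :=
        (Finset.sum_mul _ _ _).symm
    _ = (M ^ n - 1) / (M - 1) * (M ^ k)⁻¹ := by rw [geom_sum_eq hM1]
    _ = ((M ^ n - 1) * (M ^ k)⁻¹) * (M - 1)⁻¹ := by rw [div_eq_mul_inv]; ring
    _ ≤ 1 * (M - 1)⁻¹ := by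
        refine mul_le_mul_of_nonneg_right ?_ (inv_nonneg.2 hsub.le)
        rw [mul_inv_le_iff₀ hMk, one_mul]
        have : M ^ n ≤ M ^ k := pow_le_pow_right₀ hM.le hnk
        linarith
    _ = (M - 1)⁻¹ := one_mul _

/-- kernel: `L^jη = L^j/L^k` with real `L = ℓ + 1`. [folklore] -/
private theorem scaleZ_eq (ℓ k j : ℕ) : scaleZ ℓ k j = ((ℓ : ℝ) + 1) ^ j * (((ℓ : ℝ) + 1) ^ k)⁻¹ := by
  unfold scaleZ; push_cast; ring

/-- kernel: `η = L^0η ≤ L^jη`. [folklore] -/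
private theorem etaZ_le_scaleZ (ℓ k j : ℕ) : etaZ ℓ k ≤ scaleZ ℓ k j := by
  have h0 : scaleZ ℓ k 0 = etaZ ℓ k := by unfold scaleZ etaZ; rw [pow_zero, one_mul]
  rw [← h0]
  exact scaleZ_mono (Nat.zero_le j)

/-- kernel: `Σ_{j<n} L^jη ≤ 1/ℓ` (`n ≤ k`, `L = ℓ + 1 ≥ 2`). [folklore] -/
private theorem sum_scaleZ_le (hℓ : 1 ≤ ℓ) {n : ℕ} (hnk : n ≤ k) :
    ∑ j ∈ Finset.range n, scaleZ ℓ k j ≤ ((ℓ : ℝ))⁻¹ := by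
  have h1 : (1 : ℝ) ≤ ℓ := by exact_mod_cast hℓ
  have hM : (1 : ℝ) < (ℓ : ℝ) + 1 := by linarith
  calc ∑ j ∈ Finset.range n, scaleZ ℓ k j = ∑ j ∈ Finset.range n, ((ℓ : ℝ) + 1) ^ j * (((ℓ : ℝ) + 1) ^ k)⁻¹ :=
        Finset.sum_congr rfl fun j _ => scaleZ_eq ℓ k j
    _ ≤ ((ℓ : ℝ) + 1 - 1)⁻¹ := sum_geom_div_le hM hnk
    _ = ((ℓ : ℝ))⁻¹ := by rw [add_sub_cancel_right]

/-- kernel: `1 < √L`. [folklore] -/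
private theorem one_lt_sqrtL (hℓ : 1 ≤ ℓ) : 1 < Real.sqrt ((ℓ : ℝ) + 1) := by
  have h1 : (1 : ℝ) ≤ ℓ := by exact_mod_cast hℓ
  have h := Real.sqrt_lt_sqrt zero_le_one (show (1 : ℝ) < (ℓ : ℝ) + 1 by linarith)
  rwa [Real.sqrt_one] at h

/-- kernel: `((√L)^j/(√L)^k)² = L^jη`. [folklore] -/
private theorem sqrt_scale_sq (ℓ k j : ℕ) :
    (Real.sqrt ((ℓ : ℝ) + 1) ^ j * (Real.sqrt ((ℓ : ℝ) + 1) ^ k)⁻¹) ^ 2 = scaleZ ℓ k j := by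
  have hL : (0 : ℝ) ≤ (ℓ : ℝ) + 1 := by positivity
  rw [scaleZ_eq, mul_pow, inv_pow, ← pow_mul, ← pow_mul, mul_comm j 2, mul_comm k 2, pow_mul, pow_mul, Real.sq_sqrt hL]

/-- kernel: `min(L^jη, L^{j′}η) ≤ (√L)^{j−k}(√L)^{j′−k}` (the minimum is below the geometric mean). [folklore] -/
private theorem min_scaleZ_le_sqrt_mul (ℓ k j j' : ℕ) :
    min (scaleZ ℓ k j) (scaleZ ℓ k j') ≤
      (Real.sqrt ((ℓ : ℝ) + 1) ^ j * (Real.sqrt ((ℓ : ℝ) + 1) ^ k)⁻¹) *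
        (Real.sqrt ((ℓ : ℝ) + 1) ^ j' * (Real.sqrt ((ℓ : ℝ) + 1) ^ k)⁻¹) := by
  set M := Real.sqrt ((ℓ : ℝ) + 1) with hM
  have hM1 : 1 ≤ M := by
    have h0 : (0 : ℝ) ≤ ℓ := Nat.cast_nonneg ℓ
    have h := Real.sqrt_le_sqrt (show (1 : ℝ) ≤ (ℓ : ℝ) + 1 by linarith)
    rwa [Real.sqrt_one, ← hM] at h
  have hM0 : 0 < M := zero_lt_one.trans_le hM1
  have hρ0 : ∀ i, 0 ≤ M ^ i * (M ^ k)⁻¹ := fun i => by positivity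
  have hρmono : ∀ {i i' : ℕ}, i ≤ i' → M ^ i * (M ^ k)⁻¹ ≤ M ^ i' * (M ^ k)⁻¹ := fun h =>
    mul_le_mul_of_nonneg_right (pow_le_pow_right₀ hM1 h) (by positivity)
  rcases le_total j j' with h | h
  · calc min (scaleZ ℓ k j) (scaleZ ℓ k j') ≤ scaleZ ℓ k j := min_le_left _ _
      _ = (M ^ j * (M ^ k)⁻¹) * (M ^ j * (M ^ k)⁻¹) := by rw [← sq, hM, sqrt_scale_sq]
      _ ≤ (M ^ j * (M ^ k)⁻¹) * (M ^ j' * (M ^ k)⁻¹) := mul_le_mul_of_nonneg_left (hρmono h) (hρ0 j)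
  · calc min (scaleZ ℓ k j) (scaleZ ℓ k j') ≤ scaleZ ℓ k j' := min_le_right _ _
      _ = (M ^ j' * (M ^ k)⁻¹) * (M ^ j' * (M ^ k)⁻¹) := by rw [← sq, hM, sqrt_scale_sq]
      _ ≤ (M ^ j * (M ^ k)⁻¹) * (M ^ j' * (M ^ k)⁻¹) := mul_le_mul_of_nonneg_right (hρmono h) (hρ0 j')

/-- kernel: `Σ_{j,j′<n} min(L^jη, L^{j′}η) ≤ (√L − 1)^{−2}` (`n ≤ k`). [folklore] -/
private theorem sum_sum_min_scaleZ_le (hℓ : 1 ≤ ℓ) {n : ℕ} (hnk : n ≤ k) :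
    ∑ j ∈ Finset.range n, ∑ j' ∈ Finset.range n, min (scaleZ ℓ k j) (scaleZ ℓ k j') ≤
      ((Real.sqrt ((ℓ : ℝ) + 1) - 1)⁻¹) ^ 2 := by
  set M := Real.sqrt ((ℓ : ℝ) + 1) with hM
  have hM1 : 1 < M := one_lt_sqrtL hℓ
  have hM0 : 0 < M := zero_lt_one.trans hM1
  have hS : ∑ j ∈ Finset.range n, M ^ j * (M ^ k)⁻¹ ≤ (M - 1)⁻¹ := sum_geom_div_le hM1 hnk
  have hS0 : 0 ≤ ∑ j ∈ Finset.range n, M ^ j * (M ^ k)⁻¹ := Finset.sum_nonneg fun j _ => by positivity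
  calc ∑ j ∈ Finset.range n, ∑ j' ∈ Finset.range n, min (scaleZ ℓ k j) (scaleZ ℓ k j')
      ≤ ∑ j ∈ Finset.range n, ∑ j' ∈ Finset.range n, (M ^ j * (M ^ k)⁻¹) * (M ^ j' * (M ^ k)⁻¹) :=
        Finset.sum_le_sum fun j _ => Finset.sum_le_sum fun j' _ => min_scaleZ_le_sqrt_mul ℓ k j j'
    _ = (∑ j ∈ Finset.range n, M ^ j * (M ^ k)⁻¹) * (∑ j' ∈ Finset.range n, M ^ j' * (M ^ k)⁻¹) := by
        rw [Finset.sum_mul_sum]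
    _ ≤ (M - 1)⁻¹ * (M - 1)⁻¹ := mul_le_mul hS hS hS0 (inv_nonneg.2 (sub_nonneg.2 hM1.le))
    _ = ((M - 1)⁻¹) ^ 2 := (sq _).symm

/-- kernel: `Σ_{j,j′<n} (L^jη)(L^{j′}η) ≤ ℓ^{−2}` (`n ≤ k`). [folklore] -/
private theorem sum_sum_scaleZ_mul_le (hℓ : 1 ≤ ℓ) {n : ℕ} (hnk : n ≤ k) :
    ∑ j ∈ Finset.range n, ∑ j' ∈ Finset.range n, scaleZ ℓ k j * scaleZ ℓ k j' ≤ (((ℓ : ℝ))⁻¹) ^ 2 := by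
  have hS := sum_scaleZ_le (k := k) hℓ hnk
  have hS0 : 0 ≤ ∑ j ∈ Finset.range n, scaleZ ℓ k j := Finset.sum_nonneg fun j _ => (scaleZ_pos ℓ k j).le
  rw [← Finset.sum_mul_sum, sq]
  exact mul_le_mul hS hS hS0 (inv_nonneg.2 (Nat.cast_nonneg ℓ))

end Scales

/-! ## §4 Model-free pair bounds on `ℤ²` under the `d = 2` kernel laws -/

section Pairs

/-- kernel: `1/(s⁻¹ + s′⁻¹) ≤ min(s, s′)` for `s, s′ > 0`. [folklore] -/
private theorem inv_add_inv_le_min {s s' : ℝ} (hs : 0 < s) (hs' : 0 < s') : (s⁻¹ + s'⁻¹)⁻¹ ≤ min s s' := by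
  have hm : 0 < min s s' := lt_min hs hs'
  have h : (min s s')⁻¹ ≤ s⁻¹ + s'⁻¹ := by
    rcases le_total s s' with h | h
    · rw [min_eq_left h]; linarith [inv_nonneg.2 hs'.le]
    · rw [min_eq_right h]; linarith [inv_nonneg.2 hs.le]
  have := inv_anti₀ (inv_pos.2 hm) h
  rwa [inv_inv] at this

/-- **THE BRACKET OF (3.23) FOR A PAIR OF KERNELS, `d = 2`, BY ABSOLUTE VALUES.**  On `ηℤ²`, if the differentiated line obeys
`|(∂^η_μG₀)(x,x′)| ≤ As^{−1}e^{−δη|x−x′|₁/s}` and the other line `|G(x,x′)| ≤ Be^{−δη|x−x′|₁/s′}` (the `d + 1 = 2` forms of (2.10):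
powers `s^{1−2}`, `s′^{2−2}`), `η ≤ s, s′`, and `|g|, |g′| ≤ 1`, then for EVERY finite `Λ′` and every `x`:
`|[(3.23)](x)| = |Σ_{x′∈Λ′}η²(∂^η_μG₀)(x,x′)g(x)G(x,x′)g′(x′)| ≤ AB(1 + 64/δ)²·min(s,s′)²/s` — the `ℤ²` sum factorizes over the two
coordinates, each one-dimensional sum is `≤ η + 64/t ≤ min(s,s′)(1 + 64/δ)` (`t = δ(s^{−1} + s′^{−1})`).
[cite: Balaban1983Higgs3, (3.23) p.439, (2.10) p.426] -/
theorem abs_bracket323Z_pair_le_two {η A B δ s s' : ℝ} (hη : 0 < η) (hδ : 0 < δ) (hs : 0 < s) (hs' : 0 < s')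
    (hηs : η ≤ s) (hηs' : η ≤ s') (hA : 0 ≤ A) (hB : 0 ≤ B) {μ : Fin 2} {G0 G : KernelZ 1} {g g' : (Fin 2 → ℤ) → ℝ}
    (hg : ∀ x, |g x| ≤ 1) (hg' : ∀ x, |g' x| ≤ 1)
    (hD : ∀ x x' : Fin 2 → ℤ, |d1KernelZ η⁻¹ μ G0 x x'| ≤ A * s⁻¹ * Real.exp (-(δ * s⁻¹ * (η * dist₁ x x'))))
    (hG : ∀ x x' : Fin 2 → ℤ, |G x x'| ≤ B * Real.exp (-(δ * s'⁻¹ * (η * dist₁ x x'))))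
    (Λ' : Finset (Fin 2 → ℤ)) (x : Fin 2 → ℤ) :
    |bracket323Z η μ G0 G g g' Λ' x| ≤ A * B * (1 + 64 / δ) ^ 2 * ((min s s') ^ 2 * s⁻¹) := by
  have hc : 0 < δ * (s⁻¹ + s'⁻¹) := by positivity
  have hτ : 0 < δ * (s⁻¹ + s'⁻¹) * η := by positivity
  have hm : 0 < min s s' := lt_min hs hs'
  -- pointwise: the summand is bounded by `A B s⁻¹ η² e^{−τ|x−x′|₁}`
  have hpt : ∀ x' : Fin 2 → ℤ, |η ^ (1 + 1) * ker321Z η μ G0 G g g' x x'| ≤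
      A * B * s⁻¹ * (η ^ 2 * Real.exp (-((δ * (s⁻¹ + s'⁻¹) * η) * (dist₁ (d := 1) x x' : ℝ)))) := by
    intro x'
    have he : Real.exp (-(δ * s⁻¹ * (η * dist₁ (d := 1) x x'))) * Real.exp (-(δ * s'⁻¹ * (η * dist₁ (d := 1) x x'))) =
        Real.exp (-((δ * (s⁻¹ + s'⁻¹) * η) * (dist₁ (d := 1) x x' : ℝ))) := by
      rw [← Real.exp_add]; congr 1; ring
    unfold ker321Z
    rw [abs_mul, abs_of_nonneg (by positivity : (0 : ℝ) ≤ η ^ (1 + 1)), abs_mul, abs_mul, abs_mul]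
    calc η ^ (1 + 1) * (|d1KernelZ η⁻¹ μ G0 x x'| * |g x| * |G x x'| * |g' x'|)
        ≤ η ^ (1 + 1) * ((A * s⁻¹ * Real.exp (-(δ * s⁻¹ * (η * dist₁ (d := 1) x x')))) * 1 *
            (B * Real.exp (-(δ * s'⁻¹ * (η * dist₁ (d := 1) x x')))) * 1) := by
          have h1 := hD x x'
          have h2 := hg x
          have h3 := hG x x'
          have h4 := hg' x'
          have hA' : 0 ≤ A * s⁻¹ * Real.exp (-(δ * s⁻¹ * (η * dist₁ (d := 1) x x'))) := (abs_nonneg _).trans h1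
          have hB' : 0 ≤ B * Real.exp (-(δ * s'⁻¹ * (η * dist₁ (d := 1) x x'))) := (abs_nonneg _).trans h3
          gcongr
      _ = A * B * s⁻¹ * (η ^ 2 * Real.exp (-((δ * (s⁻¹ + s'⁻¹) * η) * (dist₁ (d := 1) x x' : ℝ)))) := by
          rw [← he]; ring
  -- the one-dimensional factor
  have hkey : η * (1 + 64 / (δ * (s⁻¹ + s'⁻¹) * η)) = η + 64 * (δ⁻¹ * (s⁻¹ + s'⁻¹)⁻¹) := by
    field_simp
  have hη1 : η + 64 * (δ⁻¹ * (s⁻¹ + s'⁻¹)⁻¹) ≤ min s s' * (1 + 64 / δ) := by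
    have h1 : (s⁻¹ + s'⁻¹)⁻¹ ≤ min s s' := inv_add_inv_le_min hs hs'
    have h2 : δ⁻¹ * (s⁻¹ + s'⁻¹)⁻¹ ≤ δ⁻¹ * min s s' := mul_le_mul_of_nonneg_left h1 (inv_nonneg.2 hδ.le)
    have h3 : η ≤ min s s' := le_min hηs hηs'
    calc η + 64 * (δ⁻¹ * (s⁻¹ + s'⁻¹)⁻¹) ≤ min s s' + 64 * (δ⁻¹ * min s s') := by linarith
      _ = min s s' * (1 + 64 / δ) := by rw [div_eq_mul_inv]; ring
  unfold bracket323Z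
  calc |∑ x' ∈ Λ', η ^ (1 + 1) * ker321Z η μ G0 G g g' x x'|
      ≤ ∑ x' ∈ Λ', |η ^ (1 + 1) * ker321Z η μ G0 G g g' x x'| := Finset.abs_sum_le_sum_abs _ _
    _ ≤ ∑ x' ∈ Λ', A * B * s⁻¹ * (η ^ 2 * Real.exp (-((δ * (s⁻¹ + s'⁻¹) * η) * (dist₁ (d := 1) x x' : ℝ)))) :=
        Finset.sum_le_sum fun x' _ => hpt x'
    _ = A * B * s⁻¹ * (η ^ 2 * ∑ x' ∈ Λ', Real.exp (-((δ * (s⁻¹ + s'⁻¹) * η) * (dist₁ (d := 1) x x' : ℝ)))) := by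
        rw [Finset.mul_sum, Finset.mul_sum]
    _ ≤ A * B * s⁻¹ * (η ^ 2 * (1 + 64 / (δ * (s⁻¹ + s'⁻¹) * η)) ^ 2) :=
        mul_le_mul_of_nonneg_left (mul_le_mul_of_nonneg_left (sum_exp_dist₁_le hτ x Λ') (by positivity))
          (by positivity)
    _ = A * B * s⁻¹ * (η + 64 * (δ⁻¹ * (s⁻¹ + s'⁻¹)⁻¹)) ^ 2 := by rw [← mul_pow, hkey]
    _ ≤ A * B * s⁻¹ * (min s s' * (1 + 64 / δ)) ^ 2 := by
        have h0 : 0 ≤ η + 64 * (δ⁻¹ * (s⁻¹ + s'⁻¹)⁻¹) := by positivity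
        exact mul_le_mul_of_nonneg_left (pow_le_pow_left₀ h0 hη1 2) (by positivity)
    _ = A * B * (1 + 64 / δ) ^ 2 * ((min s s') ^ 2 * s⁻¹) := by ring

/-- **THE SECOND TERM OF THE p. 439 SPLITTING FOR A PAIR OF KERNELS, `d = 2`** (*"the expression in the square bracket in (3.23)
containing the second term will be convergent"*): under the same `d = 2` laws, `|g| ≤ 1` and the Lipschitz reading
`|g′(x′) − g′(x)| ≤ K′·η|x − x′|₁` of the print's `((g′(x′) − g′(x))/|x′ − x|)|x′ − x|`, for every finite `Λ′` and every `x`: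
`|Σ_{x′∈Λ′}η²(∂^η_μG₀)(x,x′)g(x)G(x,x′)(g′(x′) − g′(x))| ≤ ABK′·128(δ^{−2} + 64δ^{−3})·min(s,s′)³/s` (the object is F1's bracket with the
weight `g′ − g′(x)`; the extra `η|x − x′|₁` is summed by the `m = 1` one-dimensional sum).
[cite: Balaban1983Higgs3, (3.23) p.439, (2.10) p.426] -/
theorem abs_second323Z_pair_le_two {η A B K' δ s s' : ℝ} (hη : 0 < η) (hδ : 0 < δ) (hs : 0 < s) (hs' : 0 < s')
    (hηs : η ≤ s) (hηs' : η ≤ s') (hA : 0 ≤ A) (hB : 0 ≤ B) (hK' : 0 ≤ K') {μ : Fin 2} {G0 G : KernelZ 1}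
    {g g' : (Fin 2 → ℤ) → ℝ} (hg : ∀ x, |g x| ≤ 1)
    (hlip : ∀ x x' : Fin 2 → ℤ, |g' x' - g' x| ≤ K' * (η * dist₁ (d := 1) x x'))
    (hD : ∀ x x' : Fin 2 → ℤ, |d1KernelZ η⁻¹ μ G0 x x'| ≤ A * s⁻¹ * Real.exp (-(δ * s⁻¹ * (η * dist₁ x x'))))
    (hG : ∀ x x' : Fin 2 → ℤ, |G x x'| ≤ B * Real.exp (-(δ * s'⁻¹ * (η * dist₁ x x'))))
    (Λ' : Finset (Fin 2 → ℤ)) (x : Fin 2 → ℤ) :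
    |bracket323Z η μ G0 G g (fun y => g' y - g' x) Λ' x| ≤
      A * B * K' * (128 * (δ⁻¹ ^ 2 + 64 * δ⁻¹ ^ 3)) * ((min s s') ^ 3 * s⁻¹) := by
  have hc : 0 < δ * (s⁻¹ + s'⁻¹) := by positivity
  have hτ : 0 < δ * (s⁻¹ + s'⁻¹) * η := by positivity
  have hm : 0 < min s s' := lt_min hs hs'
  set u : ℝ := (δ * (s⁻¹ + s'⁻¹))⁻¹ with hu
  have hu0 : 0 < u := inv_pos.2 hc
  have hum : u ≤ min s s' / δ := by
    rw [hu, mul_inv, div_eq_inv_mul]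
    exact mul_le_mul_of_nonneg_left (inv_add_inv_le_min hs hs') (inv_nonneg.2 hδ.le)
  -- pointwise
  have hpt : ∀ x' : Fin 2 → ℤ, |η ^ (1 + 1) * ker321Z η μ G0 G g (fun y => g' y - g' x) x x'| ≤
      A * B * K' * s⁻¹ * (η ^ 3 * ((dist₁ (d := 1) x x' : ℝ) *
        Real.exp (-((δ * (s⁻¹ + s'⁻¹) * η) * (dist₁ (d := 1) x x' : ℝ))))) := by
    intro x'
    have he : Real.exp (-(δ * s⁻¹ * (η * dist₁ (d := 1) x x'))) * Real.exp (-(δ * s'⁻¹ * (η * dist₁ (d := 1) x x'))) =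
        Real.exp (-((δ * (s⁻¹ + s'⁻¹) * η) * (dist₁ (d := 1) x x' : ℝ))) := by
      rw [← Real.exp_add]; congr 1; ring
    unfold ker321Z
    rw [abs_mul, abs_of_nonneg (by positivity : (0 : ℝ) ≤ η ^ (1 + 1)), abs_mul, abs_mul, abs_mul]
    calc η ^ (1 + 1) * (|d1KernelZ η⁻¹ μ G0 x x'| * |g x| * |G x x'| * |g' x' - g' x|)
        ≤ η ^ (1 + 1) * ((A * s⁻¹ * Real.exp (-(δ * s⁻¹ * (η * dist₁ (d := 1) x x')))) * 1 *
            (B * Real.exp (-(δ * s'⁻¹ * (η * dist₁ (d := 1) x x')))) * (K' * (η * dist₁ (d := 1) x x'))) := by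
          have h1 := hD x x'
          have h2 := hg x
          have h3 := hG x x'
          have h4 := hlip x x'
          have hA' : 0 ≤ A * s⁻¹ * Real.exp (-(δ * s⁻¹ * (η * dist₁ (d := 1) x x'))) := (abs_nonneg _).trans h1
          have hB' : 0 ≤ B * Real.exp (-(δ * s'⁻¹ * (η * dist₁ (d := 1) x x'))) := (abs_nonneg _).trans h3
          gcongr
      _ = A * B * K' * s⁻¹ * (η ^ 3 * ((dist₁ (d := 1) x x' : ℝ) *
            Real.exp (-((δ * (s⁻¹ + s'⁻¹) * η) * (dist₁ (d := 1) x x' : ℝ))))) := by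
          rw [← he]; ring
  -- the algebra of the constants
  have hkey : η ^ 3 * (2 * ((64 / (δ * (s⁻¹ + s'⁻¹) * η) ^ 2) * (1 + 64 / (δ * (s⁻¹ + s'⁻¹) * η)))) =
      128 * (η * u ^ 2 + 64 * u ^ 3) := by
    rw [hu]
    field_simp
    ring
  have hbd : 128 * (η * u ^ 2 + 64 * u ^ 3) ≤ 128 * (δ⁻¹ ^ 2 + 64 * δ⁻¹ ^ 3) * (min s s') ^ 3 := by
    have h3 : η ≤ min s s' := le_min hηs hηs'
    have hu2 : u ^ 2 ≤ (min s s' / δ) ^ 2 := pow_le_pow_left₀ hu0.le hum 2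
    have hu3 : u ^ 3 ≤ (min s s' / δ) ^ 3 := pow_le_pow_left₀ hu0.le hum 3
    have e1 : η * u ^ 2 ≤ min s s' * (min s s' / δ) ^ 2 := mul_le_mul h3 hu2 (by positivity) hm.le
    calc 128 * (η * u ^ 2 + 64 * u ^ 3) ≤ 128 * (min s s' * (min s s' / δ) ^ 2 + 64 * (min s s' / δ) ^ 3) := by
          nlinarith
      _ = 128 * (δ⁻¹ ^ 2 + 64 * δ⁻¹ ^ 3) * (min s s') ^ 3 := by rw [div_eq_mul_inv]; ring
  unfold bracket323Z
  calc |∑ x' ∈ Λ', η ^ (1 + 1) * ker321Z η μ G0 G g (fun y => g' y - g' x) x x'|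
      ≤ ∑ x' ∈ Λ', |η ^ (1 + 1) * ker321Z η μ G0 G g (fun y => g' y - g' x) x x'| := Finset.abs_sum_le_sum_abs _ _
    _ ≤ ∑ x' ∈ Λ', A * B * K' * s⁻¹ * (η ^ 3 * ((dist₁ (d := 1) x x' : ℝ) *
          Real.exp (-((δ * (s⁻¹ + s'⁻¹) * η) * (dist₁ (d := 1) x x' : ℝ))))) :=
        Finset.sum_le_sum fun x' _ => hpt x'
    _ = A * B * K' * s⁻¹ * (η ^ 3 * ∑ x' ∈ Λ', (dist₁ (d := 1) x x' : ℝ) *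
          Real.exp (-((δ * (s⁻¹ + s'⁻¹) * η) * (dist₁ (d := 1) x x' : ℝ)))) := by
        rw [Finset.mul_sum, Finset.mul_sum]
    _ ≤ A * B * K' * s⁻¹ * (η ^ 3 * (2 * ((64 / (δ * (s⁻¹ + s'⁻¹) * η) ^ 2) *
          (1 + 64 / (δ * (s⁻¹ + s'⁻¹) * η))))) :=
        mul_le_mul_of_nonneg_left (mul_le_mul_of_nonneg_left (sum_dist₁_mul_exp_le hτ x Λ') (by positivity))
          (by positivity)
    _ = A * B * K' * s⁻¹ * (128 * (η * u ^ 2 + 64 * u ^ 3)) := by rw [hkey]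
    _ ≤ A * B * K' * s⁻¹ * (128 * (δ⁻¹ ^ 2 + 64 * δ⁻¹ ^ 3) * (min s s') ^ 3) :=
        mul_le_mul_of_nonneg_left hbd (by positivity)
    _ = A * B * K' * (128 * (δ⁻¹ ^ 2 + 64 * δ⁻¹ ^ 3)) * ((min s s') ^ 3 * s⁻¹) := by ring

end Pairs

/-! ## §5 The laws at `d + 1 = 2` and the resummed bounds for `G_k(ηℤ², 0)` -/

section ZeroLattice

variable {ℓ k : ℕ} {a m2 : ℝ}

/-- **(2.10), VALUE CLAUSE, AT `d + 1 = 2`**: `|G^η_{(j)}(0)(x,x′)| ≤ Ce^{−½δ₁(L^jη)^{−1}η|x−x′|₁}` — NO inverse power of the scale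
in two dimensions (`(L^jη)^{2−d−1} = 1`; p26's `abs_gpieceZ_le` read at `d = 1`, rate `δ₁/2`). [cite: Balaban1983Higgs3, (2.10) p.426] -/
theorem abs_gpieceZ_le_two (hℓ : 1 ≤ ℓ) {δ₁ C : ℝ} (h210 : (zeroLatticeKernelsH 1 ℓ k hℓ a m2).Ineq210 δ₁ C)
    (hδ₁ : 0 ≤ δ₁) (j : ℕ) (x x' : Fin 2 → ℤ) :
    |gpieceZ (d := 1) ℓ k j a m2 x x'| ≤
      C * Real.exp (-(δ₁ / 2 * (scaleZ ℓ k j)⁻¹ * (etaZ ℓ k * dist₁ (d := 1) x x'))) := by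
  have hδ' : δ₁ / 2 ≤ δ₁ / ((1 + 1 : ℕ) : ℝ) := by norm_num
  have h := abs_gpieceZ_le (d := 1) hℓ h210 (δ' := δ₁ / 2) (by positivity) hδ' j x x'
  have e : scaleZ ℓ k j ^ ((2 : ℝ) - ((1 + 1 : ℕ) : ℝ)) = 1 := by norm_num
  rwa [e, mul_one] at h

/-- **(2.10), DERIVATIVE CLAUSE, AT `d + 1 = 2`**: `|(∂^η_μG^η_{(j)}(0))(x,x′)| ≤ C(L^jη)^{−1}e^{−½δ₁(L^jη)^{−1}η|x−x′|₁}` (F1's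
`abs_d1KernelZ_gpieceZ_le` read at `d = 1`, rate `δ₁/2`). [cite: Balaban1983Higgs3, (2.10) p.426] -/
theorem abs_d1KernelZ_gpieceZ_le_two (hℓ : 1 ≤ ℓ) {δ₁ C : ℝ} (h210 : (zeroLatticeKernelsH 1 ℓ k hℓ a m2).Ineq210 δ₁ C)
    (hδ₁ : 0 ≤ δ₁) (j : ℕ) (μ : Fin 2) (x x' : Fin 2 → ℤ) :
    |d1KernelZ (etaZ ℓ k)⁻¹ μ (gpieceZ (d := 1) ℓ k j a m2) x x'| ≤
      C * (scaleZ ℓ k j)⁻¹ * Real.exp (-(δ₁ / 2 * (scaleZ ℓ k j)⁻¹ * (etaZ ℓ k * dist₁ (d := 1) x x'))) := by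
  have hδ' : δ₁ / 2 ≤ δ₁ / ((1 + 1 : ℕ) : ℝ) := by norm_num
  have h := abs_d1KernelZ_gpieceZ_le (d := 1) hℓ h210 (δ' := δ₁ / 2) (by positivity) hδ' j μ x x'
  have e : scaleZ ℓ k j ^ ((1 : ℝ) - ((1 + 1 : ℕ) : ℝ)) = (scaleZ ℓ k j)⁻¹ := by norm_num [Real.rpow_neg_one]
  rwa [e] at h

/-- kernel: the first term of the p. 439 splitting is F1's bracket with the weights `g = g′ = 1`. [folklore] -/
private theorem first_eq_bracket {d : ℕ} (η : ℝ) (μ : Fin (d + 1)) (G0 G : KernelZ d) (Λ' : Finset (Fin (d + 1) → ℤ))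
    (x : Fin (d + 1) → ℤ) :
    ∑ x' ∈ Λ', η ^ (d + 1) * (d1KernelZ η⁻¹ μ G0 x x' * G x x') =
      bracket323Z η μ G0 G (fun _ => 1) (fun _ => 1) Λ' x := by
  simp only [bracket323Z, ker321Z, mul_one]

/-- **"THE EXPRESSION IN THE SQUARE BRACKET IN (3.23) … WILL BE CONVERGENT" IN `d = 2` ON THE PRINT'S CARRIER `ηℤ²`.**  For
`L = ℓ + 1 ≥ 2` and a window `[a₋,a₊] × [0,m²₊]` (`a₋ > 0`) there are `C₁, C₂ > 0` (functions of `L` and the window) such that for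
EVERY scale `k ≥ 1`, window point, resummation index `1 ≤ n ≤ k` (`𝒢_n = Σ_{j<n}G^η_{(j)}(0)`, `n = k` is `G_k(ηℤ²,0)` itself),
axis `μ`, finite `Λ′` and site `x`: (a) the FIRST TERM of the p. 439 splitting `|Σ_{x′∈Λ′}η²(∂^η_μ𝒢_n)(x,x′)𝒢_n(x,x′)| ≤ C₁`;
(b) for all localizations `|g|, |g′| ≤ 1` the WHOLE BRACKET `|[(3.23)](x)| ≤ C₁` (absolute values suffice in `d = 2`); (c) for
`|g| ≤ 1` and `g′` with `|g′(x′) − g′(x)| ≤ K′η|x − x′|₁` (`K′ ≥ 0`) the SECOND TERM `|Σ_{x′}η²(∂^η_μ𝒢_n)(x,x′)g(x)𝒢_n(x,x′)(g′(x′) −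
g′(x))| ≤ C₂K′` — uniformly in `k, n, μ, x, Λ′`, no kernel hypothesis left (the (2.10) inputs are p26's
`B3Ineq211ZeroLattice.ineq210_zeroLatticeH`).  The `ℤ²` twin of F2's `exists_first323L_GxiL_bound` / `abs_second323L_le` /
`exists_bracket323L_GxiL_bound`. [cite: Balaban1983Higgs3, (3.23) p.439, (2.10) p.426] -/
theorem exists_bracket323Z_two_bound (ℓ : ℕ) (hℓ : 1 ≤ ℓ) (amin aplus m2plus : ℝ) (ha : 0 < amin) :
    ∃ C₁ C₂ : ℝ, 0 < C₁ ∧ 0 < C₂ ∧ ∀ (k : ℕ), 1 ≤ k → ∀ (a m2 : ℝ), amin ≤ a → a ≤ aplus → 0 ≤ m2 → m2 ≤ m2plus →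
      ∀ (n : ℕ), 1 ≤ n → n ≤ k → ∀ (μ : Fin 2) (Λ' : Finset (Fin 2 → ℤ)) (x : Fin 2 → ℤ),
        |∑ x' ∈ Λ', etaZ ℓ k ^ 2 * (d1KernelZ (etaZ ℓ k)⁻¹ μ (GresumZ (d := 1) ℓ k n a m2) x x' *
            GresumZ (d := 1) ℓ k n a m2 x x')| ≤ C₁ ∧
        (∀ (g g' : (Fin 2 → ℤ) → ℝ), (∀ y, |g y| ≤ 1) → (∀ y, |g' y| ≤ 1) →
          |bracket323Z (etaZ ℓ k) μ (GresumZ (d := 1) ℓ k n a m2) (GresumZ (d := 1) ℓ k n a m2) g g' Λ' x| ≤ C₁) ∧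
        (∀ (K' : ℝ), 0 ≤ K' → ∀ (g g' : (Fin 2 → ℤ) → ℝ), (∀ y, |g y| ≤ 1) →
          (∀ y y' : Fin 2 → ℤ, |g' y' - g' y| ≤ K' * (etaZ ℓ k * dist₁ (d := 1) y y')) →
          |∑ x' ∈ Λ', etaZ ℓ k ^ 2 * (d1KernelZ (etaZ ℓ k)⁻¹ μ (GresumZ (d := 1) ℓ k n a m2) x x' * g x *
              GresumZ (d := 1) ℓ k n a m2 x x' * (g' x' - g' x))| ≤ C₂ * K') := by
  obtain ⟨δ₁, C, hδ₁, hC, h210⟩ := ineq210_zeroLatticeH 1 ℓ hℓ amin aplus m2plus ha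
  have hM1 : 1 < Real.sqrt ((ℓ : ℝ) + 1) := one_lt_sqrtL hℓ
  have hMsub : 0 < Real.sqrt ((ℓ : ℝ) + 1) - 1 := sub_pos.2 hM1
  have hℓpos : (0 : ℝ) < ℓ := by exact_mod_cast hℓ
  have hδ' : 0 < δ₁ / 2 := by positivity
  set K₁ : ℝ := C * C * (1 + 64 / (δ₁ / 2)) ^ 2 with hK₁
  set K₂ : ℝ := C * C * (128 * ((δ₁ / 2)⁻¹ ^ 2 + 64 * (δ₁ / 2)⁻¹ ^ 3)) with hK₂
  have hK₁0 : 0 < K₁ := by positivity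
  have hK₂0 : 0 < K₂ := by positivity
  refine ⟨K₁ * ((Real.sqrt ((ℓ : ℝ) + 1) - 1)⁻¹) ^ 2, K₂ * (((ℓ : ℝ))⁻¹) ^ 2, by positivity, by positivity, ?_⟩
  intro k hk a m2 h1 h2 h3 h4 n hn hnk μ Λ' x
  have h210k := h210 k hk a m2 h1 h2 h3 h4
  have hη : 0 < etaZ ℓ k := etaZ_pos ℓ k
  have hGn : GresumZ (d := 1) ℓ k n a m2 = ∑ j ∈ Finset.range n, gpieceZ ℓ k j a m2 :=
    (sum_gpieceZ_range hn hnk).symm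
  have hDj : ∀ (j : ℕ) (y y' : Fin 2 → ℤ), |d1KernelZ (etaZ ℓ k)⁻¹ μ (gpieceZ (d := 1) ℓ k j a m2) y y'| ≤
      C * (scaleZ ℓ k j)⁻¹ * Real.exp (-(δ₁ / 2 * (scaleZ ℓ k j)⁻¹ * (etaZ ℓ k * dist₁ (d := 1) y y'))) :=
    fun j y y' => abs_d1KernelZ_gpieceZ_le_two hℓ h210k hδ₁.le j μ y y'
  have hGj : ∀ (j : ℕ) (y y' : Fin 2 → ℤ), |gpieceZ (d := 1) ℓ k j a m2 y y'| ≤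
      C * Real.exp (-(δ₁ / 2 * (scaleZ ℓ k j)⁻¹ * (etaZ ℓ k * dist₁ (d := 1) y y'))) :=
    fun j y y' => abs_gpieceZ_le_two hℓ h210k hδ₁.le j y y'
  -- (b) the bracket for arbitrary bounded weights
  have key : ∀ (g g' : (Fin 2 → ℤ) → ℝ), (∀ y, |g y| ≤ 1) → (∀ y, |g' y| ≤ 1) →
      |bracket323Z (etaZ ℓ k) μ (GresumZ (d := 1) ℓ k n a m2) (GresumZ (d := 1) ℓ k n a m2) g g' Λ' x| ≤
        K₁ * ((Real.sqrt ((ℓ : ℝ) + 1) - 1)⁻¹) ^ 2 := by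
    intro g g' hg hg'
    rw [hGn, bracket323Z_sum_sum]
    calc |∑ j ∈ Finset.range n, ∑ j' ∈ Finset.range n,
            bracket323Z (etaZ ℓ k) μ (gpieceZ ℓ k j a m2) (gpieceZ ℓ k j' a m2) g g' Λ' x|
        ≤ ∑ j ∈ Finset.range n, |∑ j' ∈ Finset.range n,
            bracket323Z (etaZ ℓ k) μ (gpieceZ ℓ k j a m2) (gpieceZ ℓ k j' a m2) g g' Λ' x| :=
          Finset.abs_sum_le_sum_abs _ _
      _ ≤ ∑ j ∈ Finset.range n, ∑ j' ∈ Finset.range n,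
            |bracket323Z (etaZ ℓ k) μ (gpieceZ ℓ k j a m2) (gpieceZ ℓ k j' a m2) g g' Λ' x| :=
          Finset.sum_le_sum fun j _ => Finset.abs_sum_le_sum_abs _ _
      _ ≤ ∑ j ∈ Finset.range n, ∑ j' ∈ Finset.range n, K₁ * min (scaleZ ℓ k j) (scaleZ ℓ k j') := by
          refine Finset.sum_le_sum fun j _ => Finset.sum_le_sum fun j' _ => ?_
          have hs := scaleZ_pos ℓ k j
          have hs' := scaleZ_pos ℓ k j'
          have hpair := abs_bracket323Z_pair_le_two hη hδ' hs hs' (etaZ_le_scaleZ ℓ k j) (etaZ_le_scaleZ ℓ k j')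
            hC.le hC.le hg hg' (hDj j) (hGj j') Λ' x
          refine hpair.trans ?_
          have hmin : min (scaleZ ℓ k j) (scaleZ ℓ k j') ^ 2 * (scaleZ ℓ k j)⁻¹ ≤ min (scaleZ ℓ k j) (scaleZ ℓ k j') := by
            have h1 : min (scaleZ ℓ k j) (scaleZ ℓ k j') * (scaleZ ℓ k j)⁻¹ ≤ 1 := by
              rw [mul_inv_le_iff₀ hs, one_mul]; exact min_le_left _ _
            have h0 : 0 ≤ min (scaleZ ℓ k j) (scaleZ ℓ k j') := le_min hs.le hs'.le
            calc min (scaleZ ℓ k j) (scaleZ ℓ k j') ^ 2 * (scaleZ ℓ k j)⁻¹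
                = min (scaleZ ℓ k j) (scaleZ ℓ k j') * (min (scaleZ ℓ k j) (scaleZ ℓ k j') * (scaleZ ℓ k j)⁻¹) := by ring
              _ ≤ min (scaleZ ℓ k j) (scaleZ ℓ k j') * 1 := mul_le_mul_of_nonneg_left h1 h0
              _ = min (scaleZ ℓ k j) (scaleZ ℓ k j') := mul_one _
          calc C * C * (1 + 64 / (δ₁ / 2)) ^ 2 * (min (scaleZ ℓ k j) (scaleZ ℓ k j') ^ 2 * (scaleZ ℓ k j)⁻¹)
              ≤ C * C * (1 + 64 / (δ₁ / 2)) ^ 2 * min (scaleZ ℓ k j) (scaleZ ℓ k j') :=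
                mul_le_mul_of_nonneg_left hmin (by positivity)
            _ = K₁ * min (scaleZ ℓ k j) (scaleZ ℓ k j') := by rw [hK₁]
      _ = K₁ * ∑ j ∈ Finset.range n, ∑ j' ∈ Finset.range n, min (scaleZ ℓ k j) (scaleZ ℓ k j') := by
          rw [Finset.mul_sum]
          exact Finset.sum_congr rfl fun j _ => (Finset.mul_sum _ _ _).symm
      _ ≤ K₁ * ((Real.sqrt ((ℓ : ℝ) + 1) - 1)⁻¹) ^ 2 :=
          mul_le_mul_of_nonneg_left (sum_sum_min_scaleZ_le hℓ hnk) hK₁0.le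
  refine ⟨?_, key, ?_⟩
  · -- (a) the first term = the bracket with `g = g′ = 1`
    rw [first_eq_bracket]
    exact key _ _ (fun _ => by simp) (fun _ => by simp)
  · -- (c) the second term
    intro K' hK' g g' hg hlip
    change |bracket323Z (etaZ ℓ k) μ (GresumZ (d := 1) ℓ k n a m2) (GresumZ (d := 1) ℓ k n a m2) g
      (fun y => g' y - g' x) Λ' x| ≤ K₂ * (((ℓ : ℝ))⁻¹) ^ 2 * K'
    rw [hGn, bracket323Z_sum_sum]
    calc |∑ j ∈ Finset.range n, ∑ j' ∈ Finset.range n,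
            bracket323Z (etaZ ℓ k) μ (gpieceZ ℓ k j a m2) (gpieceZ ℓ k j' a m2) g (fun y => g' y - g' x) Λ' x|
        ≤ ∑ j ∈ Finset.range n, |∑ j' ∈ Finset.range n,
            bracket323Z (etaZ ℓ k) μ (gpieceZ ℓ k j a m2) (gpieceZ ℓ k j' a m2) g (fun y => g' y - g' x) Λ' x| :=
          Finset.abs_sum_le_sum_abs _ _
      _ ≤ ∑ j ∈ Finset.range n, ∑ j' ∈ Finset.range n,
            |bracket323Z (etaZ ℓ k) μ (gpieceZ ℓ k j a m2) (gpieceZ ℓ k j' a m2) g (fun y => g' y - g' x) Λ' x| :=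
          Finset.sum_le_sum fun j _ => Finset.abs_sum_le_sum_abs _ _
      _ ≤ ∑ j ∈ Finset.range n, ∑ j' ∈ Finset.range n, K₂ * K' * (scaleZ ℓ k j * scaleZ ℓ k j') := by
          refine Finset.sum_le_sum fun j _ => Finset.sum_le_sum fun j' _ => ?_
          have hs := scaleZ_pos ℓ k j
          have hs' := scaleZ_pos ℓ k j'
          have hpair := abs_second323Z_pair_le_two hη hδ' hs hs' (etaZ_le_scaleZ ℓ k j) (etaZ_le_scaleZ ℓ k j')
            hC.le hC.le hK' hg hlip (hDj j) (hGj j') Λ' x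
          refine hpair.trans ?_
          have h0 : 0 ≤ min (scaleZ ℓ k j) (scaleZ ℓ k j') := le_min hs.le hs'.le
          have hmin : min (scaleZ ℓ k j) (scaleZ ℓ k j') ^ 3 * (scaleZ ℓ k j)⁻¹ ≤ scaleZ ℓ k j * scaleZ ℓ k j' := by
            have h1 : min (scaleZ ℓ k j) (scaleZ ℓ k j') * (scaleZ ℓ k j)⁻¹ ≤ 1 := by
              rw [mul_inv_le_iff₀ hs, one_mul]; exact min_le_left _ _
            have h2 : min (scaleZ ℓ k j) (scaleZ ℓ k j') * min (scaleZ ℓ k j) (scaleZ ℓ k j') ≤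
                scaleZ ℓ k j * scaleZ ℓ k j' := mul_le_mul (min_le_left _ _) (min_le_right _ _) h0 hs.le
            calc min (scaleZ ℓ k j) (scaleZ ℓ k j') ^ 3 * (scaleZ ℓ k j)⁻¹
                = (min (scaleZ ℓ k j) (scaleZ ℓ k j') * min (scaleZ ℓ k j) (scaleZ ℓ k j')) *
                    (min (scaleZ ℓ k j) (scaleZ ℓ k j') * (scaleZ ℓ k j)⁻¹) := by ring
              _ ≤ (scaleZ ℓ k j * scaleZ ℓ k j') * 1 := mul_le_mul h2 h1 (by positivity) (by positivity)
              _ = scaleZ ℓ k j * scaleZ ℓ k j' := mul_one _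
          calc C * C * K' * (128 * ((δ₁ / 2)⁻¹ ^ 2 + 64 * (δ₁ / 2)⁻¹ ^ 3)) *
                (min (scaleZ ℓ k j) (scaleZ ℓ k j') ^ 3 * (scaleZ ℓ k j)⁻¹)
              ≤ C * C * K' * (128 * ((δ₁ / 2)⁻¹ ^ 2 + 64 * (δ₁ / 2)⁻¹ ^ 3)) * (scaleZ ℓ k j * scaleZ ℓ k j') :=
                mul_le_mul_of_nonneg_left hmin (by positivity)
            _ = K₂ * K' * (scaleZ ℓ k j * scaleZ ℓ k j') := by rw [hK₂]; ring
      _ = K₂ * K' * ∑ j ∈ Finset.range n, ∑ j' ∈ Finset.range n, scaleZ ℓ k j * scaleZ ℓ k j' := by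
          rw [Finset.mul_sum]
          exact Finset.sum_congr rfl fun j _ => (Finset.mul_sum _ _ _).symm
      _ ≤ K₂ * K' * (((ℓ : ℝ))⁻¹) ^ 2 :=
          mul_le_mul_of_nonneg_left (sum_sum_scaleZ_mul_le hℓ hnk) (by positivity)
      _ = K₂ * (((ℓ : ℝ))⁻¹) ^ 2 * K' := by ring

/-- **THE VERTEX (3.23) IS CONTROLLED BY ITS BRACKET** (every `d`; the `ηℤ^{d+1}` twin of F2's `abs_expr323L_le`): if
`|[(3.23)](x)| ≤ B` for all `μ` and all `x ∈ Λ` then `|expr323Z| ≤ B·Σ_μΣ_{x∈Λ}η^{d+1}‖φ(x)‖‖q²(∂^η_μφ′)(x)‖` (`η ≥ 0`) — the shape of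
*"a vertex with some convergent function"*. [cite: Balaban1983Higgs3, (3.23) p.439] -/
theorem abs_expr323Z_le_of_bracket {d : ℕ} {W : Type*} [NormedAddCommGroup W] [InnerProductSpace ℝ W] {η B : ℝ}
    (hη : 0 ≤ η) (q : W →ₗ[ℝ] W) {G0 Gj : KernelZ d} {g g' : (Fin (d + 1) → ℤ) → ℝ} {Λ Λ' : Finset (Fin (d + 1) → ℤ)}
    (hB : ∀ (μ : Fin (d + 1)), ∀ x ∈ Λ, |bracket323Z η μ G0 Gj g g' Λ' x| ≤ B) (φ φ' : (Fin (d + 1) → ℤ) → W) :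
    |expr323Z η q G0 Gj g g' φ φ' Λ Λ'| ≤
      B * ∑ μ : Fin (d + 1), ∑ x ∈ Λ, η ^ (d + 1) * (‖φ x‖ * ‖q (q (pd η⁻¹ μ φ' x))‖) := by
  unfold expr323Z
  rw [Finset.mul_sum]
  refine (Finset.abs_sum_le_sum_abs _ _).trans (Finset.sum_le_sum fun μ _ => ?_)
  rw [Finset.mul_sum]
  refine (Finset.abs_sum_le_sum_abs _ _).trans (Finset.sum_le_sum fun x hx => ?_)
  rw [abs_mul, abs_of_nonneg (by positivity : (0 : ℝ) ≤ η ^ (d + 1)), abs_mul]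
  have hi : |⟪φ x, q (q (pd η⁻¹ μ φ' x))⟫| ≤ ‖φ x‖ * ‖q (q (pd η⁻¹ μ φ' x))‖ := abs_real_inner_le_norm _ _
  have hB0 : 0 ≤ B := (abs_nonneg _).trans (hB μ x hx)
  calc η ^ (d + 1) * (|bracket323Z η μ G0 Gj g g' Λ' x| * |⟪φ x, q (q (pd η⁻¹ μ φ' x))⟫|)
      ≤ η ^ (d + 1) * (B * (‖φ x‖ * ‖q (q (pd η⁻¹ μ φ' x))‖)) :=
        mul_le_mul_of_nonneg_left (mul_le_mul (hB μ x hx) hi (abs_nonneg _) hB0) (by positivity)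
    _ = B * (η ^ (d + 1) * (‖φ x‖ * ‖q (q (pd η⁻¹ μ φ' x))‖)) := by ring

/-- **"HENCE THE LAST GRAPH IN (3.22) DEFINES A VERTEX WITH SOME CONVERGENT FUNCTION" IN `d = 2` ON `ηℤ²`** (the `ℤ²` twin of F3's
`exists_expr323Z_zeroLattice_bound`): there is `C₁ > 0` (function of `L` and the window) such that for every `k ≥ 1`, window point,
`1 ≤ n ≤ k`, ALL localizations `|g|, |g′| ≤ 1` (no Lipschitz or support hypothesis is needed in two dimensions), all finite `Λ, Λ′`,
legs `φ, φ′` and charge matrix `q`: `|expr323Z η q 𝒢_n 𝒢_n g g′ φ φ′ Λ Λ′| ≤ C₁·Σ_μΣ_{x∈Λ}η²‖φ(x)‖‖q²(∂^η_μφ′)(x)‖`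
(`𝒢_n = GresumZ ℓ k n`, `η = etaZ ℓ k`). [cite: Balaban1983Higgs3, (3.23) p.439] -/
theorem exists_expr323Z_two_bound (ℓ : ℕ) (hℓ : 1 ≤ ℓ) (amin aplus m2plus : ℝ) (ha : 0 < amin)
    {W : Type*} [NormedAddCommGroup W] [InnerProductSpace ℝ W] :
    ∃ C₁ : ℝ, 0 < C₁ ∧ ∀ (k : ℕ), 1 ≤ k → ∀ (a m2 : ℝ), amin ≤ a → a ≤ aplus → 0 ≤ m2 → m2 ≤ m2plus →
      ∀ (n : ℕ), 1 ≤ n → n ≤ k → ∀ (g g' : (Fin 2 → ℤ) → ℝ), (∀ y, |g y| ≤ 1) → (∀ y, |g' y| ≤ 1) →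
        ∀ (Λ Λ' : Finset (Fin 2 → ℤ)) (q : W →ₗ[ℝ] W) (φ φ' : (Fin 2 → ℤ) → W),
          |expr323Z (etaZ ℓ k) q (GresumZ (d := 1) ℓ k n a m2) (GresumZ (d := 1) ℓ k n a m2) g g' φ φ' Λ Λ'| ≤
            C₁ * ∑ μ : Fin 2, ∑ x ∈ Λ, etaZ ℓ k ^ 2 * (‖φ x‖ * ‖q (q (pd (etaZ ℓ k)⁻¹ μ φ' x))‖) := by
  obtain ⟨C₁, C₂, hC₁, -, h⟩ := exists_bracket323Z_two_bound ℓ hℓ amin aplus m2plus ha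
  refine ⟨C₁, hC₁, ?_⟩
  intro k hk a m2 h1 h2 h3 h4 n hn hnk g g' hg hg' Λ Λ' q φ φ'
  exact abs_expr323Z_le_of_bracket (etaZ_pos ℓ k).le q
    (fun μ x _ => (h k hk a m2 h1 h2 h3 h4 n hn hnk μ Λ' x).2.1 g g' hg hg') φ φ'

/-- **(3.22)/(3.23) END TO END IN `d = 2` ON THE PRINT'S CARRIER** (the `ℤ²` twin of F3's `sum_expr321bZ_sub_rem322Z_zeroLattice`):
with the constant of `exists_expr323Z_two_bound`, for every `k ≥ 1`, window point, `|g|, |g′| ≤ 1` and data as there, the sum over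
`j, j′ < k` of the second graphs of (3.21) with lines `G^η_{(j)}(0)`, `G^η_{(j′)}(0)` MINUS the generalized graphs `rem322Z[j,j′]` of (3.22)
(each of positive degree, F1's `abs_rem322Z_le_zeroLattice`, every `d`) is the vertex (3.23) on `G_k(ηℤ²,0)` (F1's
`sum_expr321bZ_eq_zeroLattice`, `n = k`) and is therefore bounded by `C₁·Σ_μΣ_{x∈Λ}η²‖φ(x)‖‖q²(∂^η_μφ′)(x)‖`.
[cite: Balaban1983Higgs3, (3.22)–(3.23) p.439] -/
theorem sum_expr321bZ_sub_rem322Z_two (ℓ : ℕ) (hℓ : 1 ≤ ℓ) (amin aplus m2plus : ℝ) (ha : 0 < amin)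
    {W : Type*} [NormedAddCommGroup W] [InnerProductSpace ℝ W] :
    ∃ C₁ : ℝ, 0 < C₁ ∧ ∀ (k : ℕ), 1 ≤ k → ∀ (a m2 : ℝ), amin ≤ a → a ≤ aplus → 0 ≤ m2 → m2 ≤ m2plus →
      ∀ (g g' : (Fin 2 → ℤ) → ℝ), (∀ y, |g y| ≤ 1) → (∀ y, |g' y| ≤ 1) →
        ∀ (Λ Λ' : Finset (Fin 2 → ℤ)) (q : W →ₗ[ℝ] W) (φ φ' : (Fin 2 → ℤ) → W),
          |(∑ j ∈ Finset.range k, ∑ j' ∈ Finset.range k,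
              expr321bZ (etaZ ℓ k) q (gpieceZ (d := 1) ℓ k j a m2) (gpieceZ ℓ k j' a m2) g g' φ φ' Λ Λ') -
            ∑ j ∈ Finset.range k, ∑ j' ∈ Finset.range k,
              rem322Z (etaZ ℓ k) q (gpieceZ (d := 1) ℓ k j a m2) (gpieceZ ℓ k j' a m2) g g' φ φ' Λ Λ'| ≤
            C₁ * ∑ μ : Fin 2, ∑ x ∈ Λ, etaZ ℓ k ^ 2 * (‖φ x‖ * ‖q (q (pd (etaZ ℓ k)⁻¹ μ φ' x))‖) := by
  obtain ⟨C₁, hC₁, h⟩ := exists_expr323Z_two_bound ℓ hℓ amin aplus m2plus ha (W := W)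
  refine ⟨C₁, hC₁, ?_⟩
  intro k hk a m2 h1 h2 h3 h4 g g' hg hg' Λ Λ' q φ φ'
  rw [sum_expr321bZ_eq_zeroLattice (ℓ := ℓ) (a := a) (m2 := m2) hk le_rfl q g g' φ φ' Λ Λ', add_sub_cancel_left]
  exact h k hk a m2 h1 h2 h3 h4 k hk le_rfl g g' hg hg' Λ Λ' q φ φ'

/-- kernel: `|x − x′|_∞ ≤ |x − x′|₁`. [folklore] -/
private theorem supNorm_sub_le_dist₁ (y y' : Fin 2 → ℤ) : supNorm (y - y') ≤ (dist₁ (d := 1) y y' : ℝ) := by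
  obtain ⟨i, hi⟩ := exists_supNorm_eq (y - y')
  rw [hi, Pi.sub_apply]
  have h := natAbs_sub_le_dist₁ (d := 1) y y' i
  have h' : (((y i - y' i).natAbs : ℕ) : ℝ) ≤ (dist₁ (d := 1) y y' : ℝ) := by exact_mod_cast h
  rwa [Nat.cast_natAbs] at h'

/-- **THE SECOND-TERM SENTENCE IN `d = 2` UNDER F2/F3's SUP-DISTANCE LIPSCHITZ READING**, for the record: since
`η|x − x′|_∞ ≤ η|x − x′|₁`, a localization `g′` with `|g′(y′) − g′(y)| ≤ K′·η|y − y′|_∞` (F3's hypothesis shape) satisfies ours, so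
clause (c) of `exists_bracket323Z_two_bound` holds for it with the same `C₂`. [cite: Balaban1983Higgs3, (3.23) p.439] -/
theorem exists_second323Z_two_bound_sup (ℓ : ℕ) (hℓ : 1 ≤ ℓ) (amin aplus m2plus : ℝ) (ha : 0 < amin) :
    ∃ C₂ : ℝ, 0 < C₂ ∧ ∀ (k : ℕ), 1 ≤ k → ∀ (a m2 : ℝ), amin ≤ a → a ≤ aplus → 0 ≤ m2 → m2 ≤ m2plus →
      ∀ (n : ℕ), 1 ≤ n → n ≤ k → ∀ (K' : ℝ), 0 ≤ K' → ∀ (g g' : (Fin 2 → ℤ) → ℝ), (∀ y, |g y| ≤ 1) →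
        (∀ y y' : Fin 2 → ℤ, |g' y' - g' y| ≤ K' * (etaZ ℓ k * supNorm (y - y'))) →
        ∀ (μ : Fin 2) (Λ' : Finset (Fin 2 → ℤ)) (x : Fin 2 → ℤ),
          |∑ x' ∈ Λ', etaZ ℓ k ^ 2 * (d1KernelZ (etaZ ℓ k)⁻¹ μ (GresumZ (d := 1) ℓ k n a m2) x x' * g x *
              GresumZ (d := 1) ℓ k n a m2 x x' * (g' x' - g' x))| ≤ C₂ * K' := by
  obtain ⟨C₁, C₂, -, hC₂, h⟩ := exists_bracket323Z_two_bound ℓ hℓ amin aplus m2plus ha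
  refine ⟨C₂, hC₂, ?_⟩
  intro k hk a m2 h1 h2 h3 h4 n hn hnk K' hK' g g' hg hlip μ Λ' x
  refine (h k hk a m2 h1 h2 h3 h4 n hn hnk μ Λ' x).2.2 K' hK' g g' hg (fun y y' => (hlip y y').trans ?_)
  exact mul_le_mul_of_nonneg_left (mul_le_mul_of_nonneg_left (supNorm_sub_le_dist₁ y y') (etaZ_pos ℓ k).le) hK'

end ZeroLattice

/-! ## §6 The p. 438 tadpole sentence in `d = 2`: `ηG_k(ηℤ², 0)(x, x) → 0` -/

section Tadpole

variable {ℓ k : ℕ} {a m2 : ℝ}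

/-- **`|η𝒢_n(x,x)| ≤ C·nη` ON `ηℤ²`**: each piece `G^η_{(j)}(0)(x,x)` is bounded by the (2.10) constant `C` in two dimensions (no inverse
power of `L^jη`), so the resummed diagonal `𝒢_n(x,x) = Σ_{j<n}G^η_{(j)}(0)(x,x)` is `≤ Cn` and `|η𝒢_n(x,x)| ≤ C·nη` for every `k ≥ 1`,
window point, `1 ≤ n ≤ k` and site `x` (`n = k`: `ηG_k(ηℤ²,0)(x,x) ≤ C·kL^{−k}`). [cite: Balaban1983Higgs3, (3.21) p.438, (2.10) p.426] -/
theorem exists_etaZ_mul_GresumZ_diag_two_bound (ℓ : ℕ) (hℓ : 1 ≤ ℓ) (amin aplus m2plus : ℝ) (ha : 0 < amin) :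
    ∃ C : ℝ, 0 < C ∧ ∀ (k : ℕ), 1 ≤ k → ∀ (a m2 : ℝ), amin ≤ a → a ≤ aplus → 0 ≤ m2 → m2 ≤ m2plus →
      ∀ (n : ℕ), 1 ≤ n → n ≤ k → ∀ x : Fin 2 → ℤ,
        |etaZ ℓ k * GresumZ (d := 1) ℓ k n a m2 x x| ≤ C * ((n : ℝ) * etaZ ℓ k) := by
  obtain ⟨δ₁, C, hδ₁, hC, h210⟩ := ineq210_zeroLatticeH 1 ℓ hℓ amin aplus m2plus ha
  refine ⟨C, hC, ?_⟩
  intro k hk a m2 h1 h2 h3 h4 n hn hnk x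
  have h210k := h210 k hk a m2 h1 h2 h3 h4
  have hη : 0 < etaZ ℓ k := etaZ_pos ℓ k
  have hP : ∀ j, |gpieceZ (d := 1) ℓ k j a m2 x x| ≤ C := by
    intro j
    have := abs_gpieceZ_le_two hℓ h210k hδ₁.le j x x
    simpa [dist₁_self] using this
  rw [← sum_gpieceZ_range (d := 1) hn hnk, Finset.sum_apply, Finset.sum_apply, abs_mul, abs_of_pos hη]
  calc etaZ ℓ k * |∑ j ∈ Finset.range n, gpieceZ (d := 1) ℓ k j a m2 x x|
      ≤ etaZ ℓ k * ∑ j ∈ Finset.range n, |gpieceZ (d := 1) ℓ k j a m2 x x| :=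
        mul_le_mul_of_nonneg_left (Finset.abs_sum_le_sum_abs _ _) hη.le
    _ ≤ etaZ ℓ k * ∑ _j ∈ Finset.range n, C :=
        mul_le_mul_of_nonneg_left (Finset.sum_le_sum fun j _ => hP j) hη.le
    _ = C * ((n : ℝ) * etaZ ℓ k) := by rw [Finset.sum_const, Finset.card_range, nsmul_eq_mul]; ring

/-- `kη = kL^{−k} ≤ 1` (`L ≥ 2`). [cite: Balaban1983Higgs3, (2.6) p.424] -/
theorem natCast_mul_etaZ_le_one (hℓ : 1 ≤ ℓ) (k : ℕ) : (k : ℝ) * etaZ ℓ k ≤ 1 := by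
  have hlt : k < (ℓ + 1) ^ k := Nat.lt_pow_self (by omega)
  have hpos : (0 : ℝ) < (((ℓ + 1) ^ k : ℕ) : ℝ) := by positivity
  unfold etaZ
  rw [mul_inv_le_iff₀ hpos, one_mul]
  exact_mod_cast hlt.le

/-- `kη = kL^{−k} → 0` as `k → ∞`. [cite: Balaban1983Higgs3, (2.6) p.424] -/
theorem tendsto_natCast_mul_etaZ (hℓ : 1 ≤ ℓ) : Tendsto (fun k : ℕ => (k : ℝ) * etaZ ℓ k) atTop (𝓝 0) := by
  have hL : (1 : ℝ) < (ℓ : ℝ) + 1 := by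
    have : (1 : ℝ) ≤ ℓ := by exact_mod_cast hℓ
    linarith
  have h0 : (0 : ℝ) ≤ ((ℓ : ℝ) + 1)⁻¹ := by positivity
  have h1 : ((ℓ : ℝ) + 1)⁻¹ < 1 := inv_lt_one_of_one_lt₀ hL
  have h := tendsto_self_mul_const_pow_of_lt_one h0 h1
  refine h.congr fun k => ?_
  unfold etaZ
  push_cast
  rw [inv_pow]

/-- **"ηG_k(x,x) IS CONVERGENT TO SOME FINITE CONSTANT AS η → 0" IN `d = 2` ON `ηℤ²` — THE CONSTANT IS `0`**: for every `L ≥ 2`,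
`a > 0`, `m² ≥ 0` and site `x`, `η·G_k(ηℤ²,0)(x,x) → 0` as `k → ∞` (`η = L^{−k}`; `G_k(0)` in the print's `η^{−d}`-normalisation is
`GresumZ ℓ k k = η^{−2}G_k(0)`, p26's `GresumZ_top`).  The `ℤ²` twin of p39's `B3GkTadpoleLimitZeroLattice` (`d = 3`: a non-zero
constant) and of p27's torus member `B3TadpoleZeroTorusTwoDim`. [cite: Balaban1983Higgs3, (3.21) p.438] -/
theorem tendsto_etaZ_mul_GresumZ_diag_two (ℓ : ℕ) (hℓ : 1 ≤ ℓ) (ha : 0 < a) (hm2 : 0 ≤ m2) (x : Fin 2 → ℤ) :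
    Tendsto (fun k : ℕ => etaZ ℓ k * GresumZ (d := 1) ℓ k k a m2 x x) atTop (𝓝 0) := by
  obtain ⟨C, -, h⟩ := exists_etaZ_mul_GresumZ_diag_two_bound ℓ hℓ a a m2 ha
  refine squeeze_zero_norm' ?_ (by simpa using (tendsto_natCast_mul_etaZ hℓ).const_mul C)
  filter_upwards [eventually_ge_atTop 1] with k hk
  rw [Real.norm_eq_abs]
  exact h k hk a m2 le_rfl le_rfl hm2 le_rfl k hk le_rfl x

/-- **THE FIRST GRAPH OF (3.21) IN `d = 2`: "a local vertex with the function ηG_k(x,x)", WHICH IS `≤ C·kη ≤ C` AND TENDS TO `0`.**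
There is `C > 0` (function of `L` and the window) such that for every `k ≥ 1`, window point, localization `|g| ≤ 1`, charge matrix
`q`, legs `φ, φ′` and finite `Λ`: `|expr321aZ η q 𝒢_k g φ φ′ Λ| ≤ C·(kη)·Σ_μΣ_{x∈Λ}η²‖φ(x)‖‖q²(∂^η_μφ′)(x)‖` with `kη ≤ 1`
(`natCast_mul_etaZ_le_one`) and `kη → 0` (`tendsto_natCast_mul_etaZ`) — F1's `abs_expr321aZ_le` with the vertex function bounded by
`exists_etaZ_mul_GresumZ_diag_two_bound`. [cite: Balaban1983Higgs3, (3.21) p.438] -/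
theorem exists_expr321aZ_two_bound (ℓ : ℕ) (hℓ : 1 ≤ ℓ) (amin aplus m2plus : ℝ) (ha : 0 < amin)
    {W : Type*} [NormedAddCommGroup W] [InnerProductSpace ℝ W] :
    ∃ C : ℝ, 0 < C ∧ ∀ (k : ℕ), 1 ≤ k → ∀ (a m2 : ℝ), amin ≤ a → a ≤ aplus → 0 ≤ m2 → m2 ≤ m2plus →
      ∀ (g : (Fin 2 → ℤ) → ℝ), (∀ y, |g y| ≤ 1) → ∀ (q : W →ₗ[ℝ] W) (φ φ' : (Fin 2 → ℤ) → W) (Λ : Finset (Fin 2 → ℤ)),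
        |expr321aZ (etaZ ℓ k) q (GresumZ (d := 1) ℓ k k a m2) g φ φ' Λ| ≤
          C * ((k : ℝ) * etaZ ℓ k) * ∑ μ : Fin 2, ∑ x ∈ Λ, etaZ ℓ k ^ 2 * (‖φ x‖ * ‖q (q (pd (etaZ ℓ k)⁻¹ μ φ' x))‖) := by
  obtain ⟨C, hC, h⟩ := exists_etaZ_mul_GresumZ_diag_two_bound ℓ hℓ amin aplus m2plus ha
  refine ⟨C, hC, ?_⟩
  intro k hk a m2 h1 h2 h3 h4 g hg q φ φ' Λ
  have hη : 0 < etaZ ℓ k := etaZ_pos ℓ k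
  refine abs_expr321aZ_le hη.le q _ g (fun x _ => ?_) φ φ'
  rw [abs_mul]
  calc |etaZ ℓ k * GresumZ (d := 1) ℓ k k a m2 x x| * |g x| ≤ C * ((k : ℝ) * etaZ ℓ k) * 1 :=
        mul_le_mul (h k hk a m2 h1 h2 h3 h4 k hk le_rfl x) (hg x) (abs_nonneg _) (by positivity)
    _ = C * ((k : ℝ) * etaZ ℓ k) := mul_one _

end Tadpole

end

end Literature.MathematicalPhysics.QuantumFieldTheory.Balaban1983to89.B3Eq323ZeroLatticeTwoDim
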